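import Literature.Analysis.FluidPDE.EnstrophyGronwall
import Literature.Analysis.FluidPDE.SobolevWholeSpace
import Literature.Analysis.FluidPDE.PressurePoisson
import Literature.Analysis.FluidPDE.TaoLocalisationProofs
import HarnessLib

/-!
# The enstrophy inequality under an `L³`-small plus bounded splitting of the velocity

Analysis/FluidPDE proof file (family `ns`). It supplies the a-priori estimate behind von Wahl's
theorem that `C([0, T]; L³(ℝ³))` is a regularity (and uniqueness) class for the Navier–Stokes
equations, in the form needed to reduce the named fact
`Literature.Analysis.FluidPDE.clay_solution_of_hasGlobalKatoSolution` (`NSKatoToClay.lean`) to Tao's local existence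
theorem (`NSKatoToClayTao.lean`): if a classical solution in Tao's smooth `H¹` class
(`u, ∂ₜu, p ∈ L^∞_t H^k_x`, Tao 2013, Thm. 5.4) splits on `[0, s]` as
`u(t) = a(t) + b(t)` with `|b(t)| ≤ M` and `‖a(t)‖_{L³} ≤ δ₀(ν)`, then

`∫ |∇u(s)|² ≤ exp (2M²s/ν) ∫ |∇u(0)|²`

(`NS.lintegral_frobeniusNormSq_fderiv_le_mul_exp_of_split`, packaged with the threshold in
`NS.enstrophy_le_mul_exp_of_split`). Along a solution which is continuous into `L³` such a
splitting holds uniformly on compact time intervals (height truncation of a compact family in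
`L³`, the tree's `Fluid.ContinuousInLpOn.exists_forall_eLpNorm_indicator_le`), which is how the
estimate is used.

## The computation (Lemarié-Rieusset 2016, (11.9) and Prop. 12.3)

At an interior time, with `v = u(t)`, `W = ∂ₜu(t)`, `q = p(t)`:
`d/dt ∫|∇u|² = 2 ∫ Σᵢ ⟪∂ᵢv, ∂ᵢW⟫ = -2∫⟪Δv, W⟫ = -2ν‖Δv‖²₂ + 2∫⟪Δv, (v·∇)v⟫ + 2∫⟪Δv, ∇q⟫`.
The pressure term vanishes because `div Δv = Δ div v = 0`
(`isDivFree_laplacian_of_contDiff_three`). Writing `v = a + b`,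
`|⟪Δv, (v·∇)v⟫| ≤ |Δv| (|a| + M) ‖Dv‖ ≤ (ν/2)|Δv|² + ν⁻¹|a|²‖Dv‖² + ν⁻¹M²‖Dv‖²`, and the
`L³`-small part is absorbed by the dissipation through

`∫ |a|² ‖Dv‖² ≤ Σⱼ ‖ |a| |∂ⱼv| ‖²₂ ≤ ‖a‖²₃ Σⱼ ‖∂ⱼv‖²₆ ≤ (δK)² Σⱼ ‖D∂ⱼv‖²₂ ≤ (δK)² ‖Δv‖²₂`

(Hölder `(3, 6, 2)`; the Sobolev inequality `‖w‖₆ ≤ K‖Dw‖₂` without compact support, the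
tree's `Fluid.eLpNorm_six_le_eLpNorm_fderiv_two`; and the Hessian–Laplacian identity
`Σⱼ Σᵢ ‖∂ᵢ∂ⱼv‖²₂ = ‖Δv‖²₂` for fields with three derivatives in `L²`,
`sum_sum_integral_sq_norm_fderiv_fderiv_eq_integral_sq_norm_laplacian`). With `2(δK)² ≤ ν²` this
gives `d/dt ∫|∇u|² ≤ (2M²/ν) ∫|∇u|²`, and Grönwall's lemma (the slab argument is that of
`EnstrophyGronwall.lean`, verbatim up to the slice bound).

## References

* P. G. Lemarié-Rieusset, *The Navier–Stokes Problem in the 21st Century*, CRC Press (2016),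
  Thm. 11.2 with (11.9)–(11.11) (PDF pp. 338–339) and Prop. 12.3, 4th item
  (`C([0,T], L³) ⊂ X_T^{(0)}`, von Wahl) with Thm. 12.4 (PDF pp. 391–393).
* W. von Wahl, *The equations of Navier–Stokes and abstract parabolic equations*, Vieweg (1985).
* T. Tao, Anal. PDE 6 (2013) = arXiv:1108.1165, Thm. 5.4 (the regularity class).
* E. M. Stein, *Singular Integrals and Differentiability Properties of Functions* (1970),
  Ch. III §1.3 (the `L²` Hessian–Laplacian identity).
-/

noncomputable section

open MeasureTheory Set Function Filter Topology InnerProductSpace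
open scoped ENNReal NNReal ContDiff RealInnerProductSpace Laplacian

namespace Literature.Analysis.FluidPDE

section Pointwise

variable {F : Type*} [NormedAddCommGroup F] [InnerProductSpace ℝ F]

/-- Mixed second directional derivatives of a `C²` vector field commute (Schwarz):
`∂_a ∂_b v = ∂_b ∂_a v` (Mathlib `ContDiffAt.isSymmSndFDerivAt`). [folklore] -/
theorem fderiv_fderiv_apply_comm_of_contDiff_two {v : EuclideanSpace ℝ (Fin 3) → F}
    (hv : ContDiff ℝ 2 v) (x a b : EuclideanSpace ℝ (Fin 3)) :
    fderiv ℝ (fun y => fderiv ℝ v y a) x b = fderiv ℝ (fun y => fderiv ℝ v y b) x a := by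
  have hd : DifferentiableAt ℝ (fderiv ℝ v) x :=
    ((hv.fderiv_right (m := 1) le_rfl).differentiable one_ne_zero) x
  have h22 : minSmoothness ℝ 2 ≤ (2 : ℕ∞ω) := by
    rw [minSmoothness_of_isRCLikeNormedField]
  rw [FluidPDE.fderiv_apply_const_apply hd, FluidPDE.fderiv_apply_const_apply hd]
  exact (hv.contDiffAt.isSymmSndFDerivAt h22).eq b a

/-- **`∂_a Δv = Δ ∂_a v`** for a `C³` vector field (Schwarz twice; vector-valued twin of the
tree's scalar `Fluid.fderiv_laplacian_apply`). [folklore] -/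
theorem fderiv_laplacian_apply_of_contDiff_three {v : EuclideanSpace ℝ (Fin 3) → F}
    (hv : ContDiff ℝ 3 v) (x a : EuclideanSpace ℝ (Fin 3)) :
    fderiv ℝ (Δ v) x a = (Δ (fun y => fderiv ℝ v y a)) x := by
  set b := EuclideanSpace.basisFun (Fin 3) ℝ
  have hv2 : ContDiff ℝ 2 v := hv.of_le (by norm_num)
  have hDi : ∀ w : EuclideanSpace ℝ (Fin 3), ContDiff ℝ 2 (fun y => fderiv ℝ v y w) := fun w =>
    (hv.fderiv_right (m := 2) (by norm_num)).clm_apply contDiff_const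
  have hDii : ∀ w : EuclideanSpace ℝ (Fin 3),
      ContDiff ℝ 1 (fun y => fderiv ℝ (fun z => fderiv ℝ v z w) y w) := fun w =>
    ((hDi w).fderiv_right (m := 1) (by norm_num)).clm_apply contDiff_const
  have hΔ : Δ v = fun y => ∑ i, fderiv ℝ (fun z => fderiv ℝ v z (b i)) y (b i) :=
    funext fun y => FluidPDE.laplacian_eq_sum_fderiv_fderiv b hv2 y
  rw [hΔ, fderiv_fun_sum fun i _ => ((hDii (b i)).differentiable one_ne_zero x),
    _root_.sum_apply, FluidPDE.laplacian_eq_sum_fderiv_fderiv b (hDi a) x]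
  refine Finset.sum_congr rfl fun i _ => ?_
  rw [fderiv_fderiv_apply_comm_of_contDiff_two (hDi (b i)) x (b i) a]
  have hin : (fun y => fderiv ℝ (fun z => fderiv ℝ v z (b i)) y a) =
      fun y => fderiv ℝ (fun z => fderiv ℝ v z a) y (b i) :=
    funext fun y => fderiv_fderiv_apply_comm_of_contDiff_two hv2 y (b i) a
  rw [hin]

/-- `‖Dⁿ(∂_e v)(x)‖ ≤ ‖Dⁿ⁺¹v(x)‖` for a unit basis vector `e` (the slice `∂_e v = (· e) ∘ Dv` is the
composition of `Dv` with a norm-one linear map). [folklore] -/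
theorem norm_iteratedFDeriv_fderiv_apply_basisFun_le {v : EuclideanSpace ℝ (Fin 3) → F} {N : ℕ∞}
    (hv : ContDiff ℝ N v) (n : ℕ) (hn : (n : ℕ∞) + 1 ≤ N) (x : EuclideanSpace ℝ (Fin 3)) (j : Fin 3) :
    ‖iteratedFDeriv ℝ n (fun y => fderiv ℝ v y (EuclideanSpace.basisFun (Fin 3) ℝ j)) x‖ ≤
      ‖iteratedFDeriv ℝ (n + 1) v x‖ := by
  set e := EuclideanSpace.basisFun (Fin 3) ℝ with he
  set A : (EuclideanSpace ℝ (Fin 3) →L[ℝ] F) →L[ℝ] F := ContinuousLinearMap.apply ℝ F (e j) with hA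
  have hfun : (fun y => fderiv ℝ v y (e j)) = A ∘ (fderiv ℝ v) := by
    funext y; simp [hA]
  have hD : ContDiff ℝ n (fderiv ℝ v) := hv.fderiv_right (m := n) (by exact_mod_cast hn)
  rw [hfun, A.iteratedFDeriv_comp_left hD.contDiffAt (i := n) (by exact_mod_cast le_rfl),
    ← norm_iteratedFDeriv_fderiv]
  refine (ContinuousLinearMap.norm_compContinuousMultilinearMap_le _ _).trans ?_
  have hA1 : ‖A‖ ≤ 1 := by
    rw [hA]
    refine ContinuousLinearMap.opNorm_le_bound _ zero_le_one fun L => ?_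
    rw [ContinuousLinearMap.apply_apply, one_mul]
    simpa [he] using L.le_opNorm (e j)
  calc ‖A‖ * ‖iteratedFDeriv ℝ n (fderiv ℝ v) x‖ ≤ 1 * ‖iteratedFDeriv ℝ n (fderiv ℝ v) x‖ := by
        gcongr
    _ = ‖iteratedFDeriv ℝ n (fderiv ℝ v) x‖ := one_mul _

/-- `‖Δv(x)‖ ≤ 3 ‖D²v(x)‖` on `ℝ³` for `C²` fields (`Δv = Σᵢ ∂ᵢ∂ᵢv` and `‖∂ᵢ∂ᵢv‖ ≤ ‖D²v‖`). [folklore] -/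
theorem norm_laplacian_le_three_mul_norm_iteratedFDeriv_two {v : EuclideanSpace ℝ (Fin 3) → F}
    (hv : ContDiff ℝ 2 v) (x : EuclideanSpace ℝ (Fin 3)) :
    ‖(Δ v) x‖ ≤ 3 * ‖iteratedFDeriv ℝ 2 v x‖ := by
  rw [FluidPDE.laplacian_eq_sum_fderiv_fderiv (EuclideanSpace.basisFun (Fin 3) ℝ) hv x]
  calc ‖∑ i, fderiv ℝ (fun y => fderiv ℝ v y (EuclideanSpace.basisFun (Fin 3) ℝ i)) x
          (EuclideanSpace.basisFun (Fin 3) ℝ i)‖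
      ≤ ∑ i, ‖fderiv ℝ (fun y => fderiv ℝ v y (EuclideanSpace.basisFun (Fin 3) ℝ i)) x
          (EuclideanSpace.basisFun (Fin 3) ℝ i)‖ := norm_sum_le _ _
    _ ≤ ∑ _i : Fin 3, ‖iteratedFDeriv ℝ 2 v x‖ :=
        Finset.sum_le_sum fun i _ => norm_fderiv_fderiv_apply_basisFun_le hv x i
    _ = 3 * ‖iteratedFDeriv ℝ 2 v x‖ := by simp

/-- The Laplacian of a `C³` field is `C¹` (`Δv = Σᵢ ∂ᵢ∂ᵢv`). [folklore] -/
theorem contDiff_one_laplacian_of_contDiff_three {v : EuclideanSpace ℝ (Fin 3) → F}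
    (hv : ContDiff ℝ 3 v) : ContDiff ℝ 1 (Δ v) := by
  set b := EuclideanSpace.basisFun (Fin 3) ℝ
  have hv2 : ContDiff ℝ 2 v := hv.of_le (by norm_num)
  have hDi : ∀ w : EuclideanSpace ℝ (Fin 3), ContDiff ℝ 2 (fun y => fderiv ℝ v y w) := fun w =>
    (hv.fderiv_right (m := 2) (by norm_num)).clm_apply contDiff_const
  have hDii : ∀ w : EuclideanSpace ℝ (Fin 3),
      ContDiff ℝ 1 (fun y => fderiv ℝ (fun z => fderiv ℝ v z w) y w) := fun w =>
    ((hDi w).fderiv_right (m := 1) (by norm_num)).clm_apply contDiff_const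
  have hΔ : Δ v = fun y => ∑ i, fderiv ℝ (fun z => fderiv ℝ v z (b i)) y (b i) :=
    funext fun y => FluidPDE.laplacian_eq_sum_fderiv_fderiv b hv2 y
  rw [hΔ]
  exact ContDiff.sum fun i _ => hDii (b i)

end Pointwise

/-! ### The Hessian–Laplacian identity in `L²` -/

section Hessian

/-- **`Σⱼ Σᵢ ∫ ‖∂ᵢ∂ⱼv‖² = ∫ ‖Δv‖²`** for a `C³` field on `ℝ³` with `Dv, D²v, D³v ∈ L²` (two
integrations by parts, `Σᵢ∫⟪∂ᵢ∂ⱼv, ∂ᵢ∂ⱼv⟫ = -∫⟪Δ∂ⱼv, ∂ⱼv⟫ = -∫⟪∂ⱼΔv, ∂ⱼv⟫` and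
`Σⱼ∫⟪∂ⱼv, ∂ⱼΔv⟫ = -∫⟪Δv, Δv⟫`; no compact support is needed, the `L²` hypotheses making all
products integrable). The `L²` case of Stein 1970, Ch. III §1.3, Prop. 3; whole-space twin of the
tree's compactly supported `Fluid.integral_sum_sq_fderiv_fderiv_eq_integral_laplacian_sq`. [folklore] -/
theorem sum_sum_integral_sq_norm_fderiv_fderiv_eq_integral_sq_norm_laplacian
    {v : EuclideanSpace ℝ (Fin 3) → EuclideanSpace ℝ (Fin 3)} (hv : ContDiff ℝ 3 v)
    (hv1 : ∫⁻ x, ‖iteratedFDeriv ℝ 1 v x‖ₑ ^ 2 < ⊤) (hv2 : ∫⁻ x, ‖iteratedFDeriv ℝ 2 v x‖ₑ ^ 2 < ⊤)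
    (hv3 : ∫⁻ x, ‖iteratedFDeriv ℝ 3 v x‖ₑ ^ 2 < ⊤) :
    ∑ j, ∑ i, ∫ x, ‖fderiv ℝ (fun y => fderiv ℝ v y (EuclideanSpace.basisFun (Fin 3) ℝ j)) x
        (EuclideanSpace.basisFun (Fin 3) ℝ i)‖ ^ 2 = ∫ x, ‖(Δ v) x‖ ^ 2 := by
  set e := EuclideanSpace.basisFun (Fin 3) ℝ with he
  have he1 : ∀ i, ‖e i‖ = 1 := fun i => by simp [he]
  have hv2' : ContDiff ℝ 2 v := hv.of_le (by norm_num)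
  have hv1' : ContDiff ℝ 1 v := hv.of_le (by norm_num)
  -- the slices `vⱼ = ∂ⱼ v`
  set vs : Fin 3 → EuclideanSpace ℝ (Fin 3) → EuclideanSpace ℝ (Fin 3) := fun j y => fderiv ℝ v y (e j)
    with hvs
  have hvs2 : ∀ j, ContDiff ℝ 2 (vs j) := fun j =>
    (hv.fderiv_right (m := 2) (by norm_num)).clm_apply contDiff_const
  have hvs1 : ∀ j, ContDiff ℝ 1 (vs j) := fun j => (hvs2 j).of_le (by norm_num)
  have hΔ1 : ContDiff ℝ 1 (Δ v) := contDiff_one_laplacian_of_contDiff_three hv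
  -- continuity
  have cD1 : Continuous fun x => iteratedFDeriv ℝ 1 v x := hv.continuous_iteratedFDeriv (by norm_num)
  have cD2 : Continuous fun x => iteratedFDeriv ℝ 2 v x := hv.continuous_iteratedFDeriv (by norm_num)
  have cD3 : Continuous fun x => iteratedFDeriv ℝ 3 v x := hv.continuous_iteratedFDeriv (by norm_num)
  have cvs : ∀ j, Continuous (vs j) := fun j => (hvs1 j).continuous
  have cdvs : ∀ j i, Continuous fun x => fderiv ℝ (vs j) x (e i) := fun j i =>
    ((hvs1 j).continuous_fderiv one_ne_zero).clm_apply continuous_const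
  have cddvs : ∀ j i, Continuous fun x => fderiv ℝ (fun y => fderiv ℝ (vs j) y (e i)) x (e i) :=
    fun j i => (((((hvs2 j).fderiv_right (m := 1) (by norm_num)).clm_apply contDiff_const).continuous_fderiv
      one_ne_zero).clm_apply continuous_const)
  have cΔ : Continuous (Δ v) := hΔ1.continuous
  have cdΔ : ∀ j, Continuous fun x => fderiv ℝ (Δ v) x (e j) := fun j =>
    (hΔ1.continuous_fderiv one_ne_zero).clm_apply continuous_const
  -- pointwise norm bounds by `‖Dᵏv‖`
  have n_vs : ∀ j x, ‖vs j x‖ ≤ ‖iteratedFDeriv ℝ 1 v x‖ := fun j x =>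
    norm_fderiv_apply_basisFun_le v x j
  have n_dvs : ∀ j i x, ‖fderiv ℝ (vs j) x (e i)‖ ≤ ‖iteratedFDeriv ℝ 2 v x‖ := fun j i x =>
    (norm_fderiv_apply_basisFun_le (vs j) x i).trans
      (norm_iteratedFDeriv_fderiv_apply_basisFun_le hv 1 (by norm_num) x j)
  have n_ddvs : ∀ j i x, ‖fderiv ℝ (fun y => fderiv ℝ (vs j) y (e i)) x (e i)‖ ≤
      ‖iteratedFDeriv ℝ 3 v x‖ := fun j i x =>
    (norm_fderiv_fderiv_apply_basisFun_le (hvs2 j) x i).trans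
      (norm_iteratedFDeriv_fderiv_apply_basisFun_le hv 2 (by norm_num) x j)
  have n_Δ : ∀ x, ‖(Δ v) x‖ ≤ ‖(3 : ℝ) • iteratedFDeriv ℝ 2 v x‖ := fun x => by
    rw [norm_smul, Real.norm_of_nonneg (by norm_num : (0 : ℝ) ≤ 3)]
    exact norm_laplacian_le_three_mul_norm_iteratedFDeriv_two hv2' x
  have n_dΔ : ∀ j x, ‖fderiv ℝ (Δ v) x (e j)‖ ≤ ‖(3 : ℝ) • iteratedFDeriv ℝ 3 v x‖ := fun j x => by
    rw [norm_smul, Real.norm_of_nonneg (by norm_num : (0 : ℝ) ≤ 3),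
      fderiv_laplacian_apply_of_contDiff_three hv x (e j)]
    exact (norm_laplacian_le_three_mul_norm_iteratedFDeriv_two (hvs2 j) x).trans
      (mul_le_mul_of_nonneg_left (norm_iteratedFDeriv_fderiv_apply_basisFun_le hv 2 (by norm_num) x j)
        (by norm_num))
  -- finiteness of `∫ ‖3 • Dᵏv‖²`
  have l2_smul : ∀ {k : ℕ}, ∫⁻ x, ‖iteratedFDeriv ℝ k v x‖ₑ ^ 2 < ⊤ →
      ∫⁻ x, ‖(3 : ℝ) • iteratedFDeriv ℝ k v x‖ₑ ^ 2 < ⊤ := by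
    intro k hk
    have : ∀ x, ‖(3 : ℝ) • iteratedFDeriv ℝ k v x‖ₑ ^ 2 =
        ENNReal.ofReal (3 ^ 2) * ‖iteratedFDeriv ℝ k v x‖ₑ ^ 2 := by
      intro x
      rw [enorm_smul, mul_pow, Real.enorm_eq_ofReal (by norm_num : (0:ℝ) ≤ 3),
        ENNReal.ofReal_pow (by norm_num : (0:ℝ) ≤ 3)]
    simp_rw [this]
    rw [lintegral_const_mul' _ _ ENNReal.ofReal_ne_top]
    exact ENNReal.mul_lt_top ENNReal.ofReal_lt_top hk
  have c3D2 : Continuous fun x => (3 : ℝ) • iteratedFDeriv ℝ 2 v x := cD2.const_smul (3 : ℝ)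
  have c3D3 : Continuous fun x => (3 : ℝ) • iteratedFDeriv ℝ 3 v x := cD3.const_smul (3 : ℝ)
  -- integrability of the products
  have i_a1 : ∀ j i, Integrable (fun x => ⟪fderiv ℝ (fun y => fderiv ℝ (vs j) y (e i)) x (e i), vs j x⟫)
      volume := fun j i =>
    integrable_of_norm_le_mul_of_lintegral_sq ((cddvs j i).inner (cvs j)).aestronglyMeasurable
      cD3 cD1 hv3 hv1 fun x => (norm_inner_le_norm _ _).trans
        (mul_le_mul (n_ddvs j i x) (n_vs j x) (norm_nonneg _) (norm_nonneg _))
  have i_a2 : ∀ j i, Integrable (fun x => ⟪fderiv ℝ (vs j) x (e i), fderiv ℝ (vs j) x (e i)⟫)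
      volume := fun j i =>
    integrable_of_norm_le_mul_of_lintegral_sq ((cdvs j i).inner (cdvs j i)).aestronglyMeasurable
      cD2 cD2 hv2 hv2 fun x => (norm_inner_le_norm _ _).trans
        (mul_le_mul (n_dvs j i x) (n_dvs j i x) (norm_nonneg _) (norm_nonneg _))
  have i_a3 : ∀ j i, Integrable (fun x => ⟪fderiv ℝ (vs j) x (e i), vs j x⟫) volume := fun j i =>
    integrable_of_norm_le_mul_of_lintegral_sq ((cdvs j i).inner (cvs j)).aestronglyMeasurable
      cD2 cD1 hv2 hv1 fun x => (norm_inner_le_norm _ _).trans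
        (mul_le_mul (n_dvs j i x) (n_vs j x) (norm_nonneg _) (norm_nonneg _))
  have i_b1 : ∀ j, Integrable (fun x => ⟪fderiv ℝ (fun y => fderiv ℝ v y (e j)) x (e j), (Δ v) x⟫)
      volume := fun j =>
    integrable_of_norm_le_mul_of_lintegral_sq ((cdvs j j).inner cΔ).aestronglyMeasurable
      cD2 c3D2 hv2 (l2_smul hv2) fun x => (norm_inner_le_norm _ _).trans
        (mul_le_mul (norm_fderiv_fderiv_apply_basisFun_le hv2' x j) (n_Δ x) (norm_nonneg _)
          (norm_nonneg _))
  have i_b2 : ∀ j, Integrable (fun x => ⟪fderiv ℝ v x (e j), fderiv ℝ (Δ v) x (e j)⟫) volume :=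
    fun j => integrable_of_norm_le_mul_of_lintegral_sq ((cvs j).inner (cdΔ j)).aestronglyMeasurable
      cD1 c3D3 hv1 (l2_smul hv3) fun x => (norm_inner_le_norm _ _).trans
        (mul_le_mul (n_vs j x) (n_dΔ j x) (norm_nonneg _) (norm_nonneg _))
  have i_b3 : ∀ j, Integrable (fun x => ⟪fderiv ℝ v x (e j), (Δ v) x⟫) volume := fun j =>
    integrable_of_norm_le_mul_of_lintegral_sq ((cvs j).inner cΔ).aestronglyMeasurable
      cD1 c3D2 hv1 (l2_smul hv2) fun x => (norm_inner_le_norm _ _).trans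
        (mul_le_mul (n_vs j x) (n_Δ x) (norm_nonneg _) (norm_nonneg _))
  -- (a) first Green identity for each slice `vⱼ`
  have ha : ∀ j, ∫ x, ∑ i, ⟪fderiv ℝ (vs j) x (e i), fderiv ℝ (vs j) x (e i)⟫ =
      - ∫ x, ⟪(Δ (vs j)) x, vs j x⟫ := fun j =>
    integral_sum_inner_fderiv_fderiv_eq_neg_integral_inner_laplacian (hvs2 j) (hvs1 j)
      (i_a1 j) (i_a2 j) (i_a3 j)
  -- (b) Green identity for the pair `(v, Δv)`
  have hb : ∫ x, ∑ j, ⟪fderiv ℝ v x (e j), fderiv ℝ (Δ v) x (e j)⟫ = - ∫ x, ⟪(Δ v) x, (Δ v) x⟫ :=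
    integral_sum_inner_fderiv_fderiv_eq_neg_integral_inner_laplacian hv2' hΔ1 i_b1 i_b2 i_b3
  -- (c) `⟪Δ∂ⱼv, ∂ⱼv⟫ = ⟪∂ⱼv, ∂ⱼΔv⟫`
  have hc : ∀ j x, ⟪(Δ (vs j)) x, vs j x⟫ = ⟪fderiv ℝ v x (e j), fderiv ℝ (Δ v) x (e j)⟫ := by
    intro j x
    rw [fderiv_laplacian_apply_of_contDiff_three hv x (e j), real_inner_comm]
  -- (d) assemble
  have hsq : ∀ j i, (fun x => ‖fderiv ℝ (vs j) x (e i)‖ ^ 2) =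
      fun x => ⟪fderiv ℝ (vs j) x (e i), fderiv ℝ (vs j) x (e i)⟫ := fun j i =>
    funext fun x => (real_inner_self_eq_norm_sq _).symm
  have hj : ∀ j, ∑ i, ∫ x, ‖fderiv ℝ (vs j) x (e i)‖ ^ 2 =
      - ∫ x, ⟪fderiv ℝ v x (e j), fderiv ℝ (Δ v) x (e j)⟫ := by
    intro j
    simp_rw [hsq]
    rw [← integral_finsetSum _ fun i _ => i_a2 j i, ha j]
    congr 1
    exact integral_congr_ae (Eventually.of_forall fun x => hc j x)
  refine (Finset.sum_congr rfl fun j _ => hj j).trans ?_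
  rw [Finset.sum_neg_distrib, ← integral_finsetSum _ fun j _ => i_b2 j, hb, neg_neg]
  exact integral_congr_ae (Eventually.of_forall fun x => real_inner_self_eq_norm_sq _)

end Hessian

/-! ### Divergence-free fields: derivative slices and the Laplacian -/

section DivFree

/-- The Laplacian of a divergence-free `C³` field on `ℝ³` is divergence free
(`Δv = Σᵢ ∂ᵢ∂ᵢv`, and the tree's `Fluid.IsDivFree.fderiv_apply` twice). [folklore] -/
theorem isDivFree_laplacian_of_contDiff_three
    {v : EuclideanSpace ℝ (Fin 3) → EuclideanSpace ℝ (Fin 3)} (hv : ContDiff ℝ 3 v)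
    (hdiv : VectorCalculus.IsDivFree v) : VectorCalculus.IsDivFree (Δ v) := by
  set b := EuclideanSpace.basisFun (Fin 3) ℝ
  have hv2 : ContDiff ℝ 2 v := hv.of_le (by norm_num)
  have hDi : ∀ w : EuclideanSpace ℝ (Fin 3), ContDiff ℝ 2 (fun y => fderiv ℝ v y w) := fun w =>
    (hv.fderiv_right (m := 2) (by norm_num)).clm_apply contDiff_const
  have hDii : ∀ w : EuclideanSpace ℝ (Fin 3),
      ContDiff ℝ 1 (fun y => fderiv ℝ (fun z => fderiv ℝ v z w) y w) := fun w =>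
    ((hDi w).fderiv_right (m := 1) (by norm_num)).clm_apply contDiff_const
  have hΔ : Δ v = fun y => ∑ i, fderiv ℝ (fun z => fderiv ℝ v z (b i)) y (b i) :=
    funext fun y => FluidPDE.laplacian_eq_sum_fderiv_fderiv b hv2 y
  have hdd : ∀ i, VectorCalculus.IsDivFree (fun y => fderiv ℝ (fun z => fderiv ℝ v z (b i)) y (b i)) :=
    fun i => VectorCalculus.IsDivFree.fderiv_apply (hDi (b i))
      (VectorCalculus.IsDivFree.fderiv_apply hv2 hdiv (b i)) (b i)
  intro x
  rw [hΔ, FluidPDE.divergence_eq_traceCLM,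
    fderiv_fun_sum fun i _ => ((hDii (b i)).differentiable one_ne_zero x), map_sum]
  exact Finset.sum_eq_zero fun i _ => hdd i x

end DivFree

/-! ### `L²` bookkeeping -/

section L2Helpers

/-- `∫⁻ ‖g‖ₑ² = ‖g‖²_{L²}`. [folklore] -/
theorem lintegral_enorm_sq_eq_eLpNorm_two_sq {α : Type*} [MeasurableSpace α] (μ : Measure α)
    {G : Type*} [NormedAddCommGroup G] (g : α → G) : ∫⁻ x, ‖g x‖ₑ ^ 2 ∂μ = eLpNorm g 2 μ ^ 2 := by
  have h := eLpNorm_nnreal_pow_eq_lintegral (f := g) (μ := μ) (p := (2 : ℝ≥0)) two_ne_zero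
  simp only [ENNReal.coe_ofNat, NNReal.coe_ofNat, ENNReal.rpow_two] at h
  rw [h]

/-- `‖g‖_{L²} < ∞` from `∫⁻ ‖g‖ₑ² < ∞`. [folklore] -/
theorem eLpNorm_two_lt_top_of_lintegral_enorm_sq_lt_top {α : Type*} [MeasurableSpace α]
    {μ : Measure α} {G : Type*} [NormedAddCommGroup G] {g : α → G}
    (h : ∫⁻ x, ‖g x‖ₑ ^ 2 ∂μ < ⊤) : eLpNorm g 2 μ < ⊤ := by
  rw [lintegral_enorm_sq_eq_eLpNorm_two_sq] at h
  refine lt_top_iff_ne_top.2 fun htop => ?_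
  rw [htop] at h
  simp at h

end L2Helpers

/-! ### The key estimate: `∫ |a|² |∇v|² ≤ (δK)² ∫ |Δv|²` for `‖a‖_{L³} ≤ δ` -/

section KeyEstimate

/-- **The `L³`-small part of the convective term is absorbed by the dissipation.** For a `C³`
field `v` on `ℝ³` with `Dv, D²v, D³v ∈ L²` and a measurable, bounded field `a` with
`‖a‖_{L³} ≤ δ`:
`∫ |a|² ‖Dv‖² ≤ (δ K)² ∫ |Δv|²`, `K` the constant of the Sobolev inequality
`‖w‖_{L⁶} ≤ K ‖Dw‖_{L²}` (Mathlib `SNormLESNormFDerivOfEqConst`). Proof: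
`‖Dv‖² ≤ Σⱼ ‖∂ⱼv‖²` pointwise; Hölder `‖ |a| |∂ⱼv| ‖_{L²} ≤ ‖a‖_{L³} ‖∂ⱼv‖_{L⁶}`; Sobolev
`‖∂ⱼv‖_{L⁶} ≤ K ‖D∂ⱼv‖_{L²}`; and the Hessian–Laplacian identity
`Σⱼ ‖D∂ⱼv‖²_{L²} ≤ Σⱼ Σᵢ ‖∂ᵢ∂ⱼv‖²_{L²} = ‖Δv‖²_{L²}`. (The boundedness of `a` only serves the
integrability of the left-hand side.) This is the mechanism of von Wahl's uniqueness class
`C([0,T]; L³)` (Lemarié-Rieusset 2016, Prop. 12.3, 4th item). [folklore] -/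
theorem integral_sq_norm_mul_norm_fderiv_le_of_eLpNorm_three_le
    {v : EuclideanSpace ℝ (Fin 3) → EuclideanSpace ℝ (Fin 3)} (hv : ContDiff ℝ 3 v)
    (hv1 : ∫⁻ x, ‖iteratedFDeriv ℝ 1 v x‖ₑ ^ 2 < ⊤) (hv2 : ∫⁻ x, ‖iteratedFDeriv ℝ 2 v x‖ₑ ^ 2 < ⊤)
    (hv3 : ∫⁻ x, ‖iteratedFDeriv ℝ 3 v x‖ₑ ^ 2 < ⊤)
    {a : EuclideanSpace ℝ (Fin 3) → EuclideanSpace ℝ (Fin 3)} (ham : AEStronglyMeasurable a volume)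
    {C : ℝ} (haC : ∀ x, ‖a x‖ ≤ C) {δ : ℝ} (hδ0 : 0 ≤ δ)
    (ha3 : eLpNorm a 3 volume ≤ ENNReal.ofReal δ) :
    ∫ x, (‖a x‖ * ‖fderiv ℝ v x‖) ^ 2 ≤
      (δ * (SNormLESNormFDerivOfEqConst (EuclideanSpace ℝ (Fin 3))
        (volume : Measure (EuclideanSpace ℝ (Fin 3))) 2 : ℝ)) ^ 2 * ∫ x, ‖(Δ v) x‖ ^ 2 := by
  set e := EuclideanSpace.basisFun (Fin 3) ℝ with he
  set K : ℝ≥0 := SNormLESNormFDerivOfEqConst (EuclideanSpace ℝ (Fin 3))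
    (volume : Measure (EuclideanSpace ℝ (Fin 3))) 2 with hK
  haveI : ENNReal.HolderTriple 3 6 2 := by
    constructor
    have h3 : (3 : ℝ≥0∞) = ((3 : ℝ≥0) : ℝ≥0∞) := by norm_cast
    have h6 : (6 : ℝ≥0∞) = ((6 : ℝ≥0) : ℝ≥0∞) := by norm_cast
    have h2 : (2 : ℝ≥0∞) = ((2 : ℝ≥0) : ℝ≥0∞) := by norm_cast
    rw [h3, h6, h2, ← ENNReal.coe_inv (by norm_num), ← ENNReal.coe_inv (by norm_num),
      ← ENNReal.coe_inv (by norm_num), ← ENNReal.coe_add]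
    congr 1
    rw [← NNReal.coe_inj]
    push_cast
    norm_num
  have hv2' : ContDiff ℝ 2 v := hv.of_le (by norm_num)
  have hC0 : 0 ≤ C := (norm_nonneg _).trans (haC 0)
  -- the slices `∂ⱼ v` and the second slices `∂ᵢ∂ⱼ v`
  set vs : Fin 3 → EuclideanSpace ℝ (Fin 3) → EuclideanSpace ℝ (Fin 3) :=
    fun j y => fderiv ℝ v y (e j) with hvs
  have hvs2 : ∀ j, ContDiff ℝ 2 (vs j) := fun j =>
    (hv.fderiv_right (m := 2) (by norm_num)).clm_apply contDiff_const
  have hvs1 : ∀ j, ContDiff ℝ 1 (vs j) := fun j => (hvs2 j).of_le (by norm_num)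
  have cD1 : Continuous fun x => iteratedFDeriv ℝ 1 v x := hv.continuous_iteratedFDeriv (by norm_num)
  have cD2 : Continuous fun x => iteratedFDeriv ℝ 2 v x := hv.continuous_iteratedFDeriv (by norm_num)
  have cDv : Continuous (fderiv ℝ v) := hv.continuous_fderiv (by norm_num)
  have cvs : ∀ j, Continuous (vs j) := fun j => (hvs1 j).continuous
  have cDvs : ∀ j, Continuous (fderiv ℝ (vs j)) := fun j => (hvs1 j).continuous_fderiv one_ne_zero
  have cdvs : ∀ j i, Continuous fun x => fderiv ℝ (vs j) x (e i) := fun j i =>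
    (cDvs j).clm_apply continuous_const
  -- pointwise norm bounds
  have n_vs : ∀ j x, ‖vs j x‖ ≤ ‖iteratedFDeriv ℝ 1 v x‖ := fun j x =>
    norm_fderiv_apply_basisFun_le v x j
  have n_dvs : ∀ j i x, ‖fderiv ℝ (vs j) x (e i)‖ ≤ ‖iteratedFDeriv ℝ 2 v x‖ := fun j i x =>
    (norm_fderiv_apply_basisFun_le (vs j) x i).trans
      (norm_iteratedFDeriv_fderiv_apply_basisFun_le hv 1 (by norm_num) x j)
  -- `L²` finiteness
  have l2vs : ∀ j, ∫⁻ x, ‖vs j x‖ₑ ^ 2 < ⊤ := fun j =>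
    lintegral_enorm_sq_lt_top_of_norm_le (n_vs j) hv1
  have l2dvs : ∀ j i, ∫⁻ x, ‖fderiv ℝ (vs j) x (e i)‖ₑ ^ 2 < ⊤ := fun j i =>
    lintegral_enorm_sq_lt_top_of_norm_le (n_dvs j i) hv2
  -- the right-hand side quantities `Rⱼ = Σᵢ ∫ ‖∂ᵢ∂ⱼv‖²`
  have i_dd : ∀ j i, Integrable (fun x => ‖fderiv ℝ (vs j) x (e i)‖ ^ 2) volume := fun j i =>
    FluidPDE.integrable_sq_norm_of_lintegral_lt_top (cdvs j i) (l2dvs j i)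
  set R : Fin 3 → ℝ := fun j => ∑ i, ∫ x, ‖fderiv ℝ (vs j) x (e i)‖ ^ 2 with hR
  have hR0 : ∀ j, 0 ≤ R j := fun j => Finset.sum_nonneg fun i _ => integral_nonneg fun x => sq_nonneg _
  have hRsum : ∀ j, R j = ∫ x, ∑ i, ‖fderiv ℝ (vs j) x (e i)‖ ^ 2 := fun j =>
    (integral_finsetSum _ fun i _ => i_dd j i).symm
  have hHess : ∑ j, R j = ∫ x, ‖(Δ v) x‖ ^ 2 :=
    sum_sum_integral_sq_norm_fderiv_fderiv_eq_integral_sq_norm_laplacian hv hv1 hv2 hv3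
  -- the products `gⱼ = |a| |∂ⱼ v|`
  set g : Fin 3 → EuclideanSpace ℝ (Fin 3) → ℝ := fun j x => ‖a x‖ * ‖vs j x‖ with hg
  have hg0 : ∀ j x, 0 ≤ g j x := fun j x => mul_nonneg (norm_nonneg _) (norm_nonneg _)
  have hgm : ∀ j, AEStronglyMeasurable (g j) volume := fun j =>
    ham.norm.mul (cvs j).norm.aestronglyMeasurable
  have i_g2 : ∀ j, Integrable (fun x => g j x ^ 2) volume := by
    intro j
    have hdom : Integrable (fun x => C ^ 2 * ‖vs j x‖ ^ 2) volume :=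
      (FluidPDE.integrable_sq_norm_of_lintegral_lt_top (cvs j) (l2vs j)).const_mul _
    refine hdom.mono' ((hgm j).pow 2) (Eventually.of_forall fun x => ?_)
    rw [Real.norm_of_nonneg (sq_nonneg _), hg]
    dsimp only
    rw [mul_pow]
    exact mul_le_mul_of_nonneg_right (pow_le_pow_left₀ (norm_nonneg _) (haC x) 2) (sq_nonneg _)
  -- Step 1: pointwise `(|a| ‖Dv‖)² ≤ Σⱼ gⱼ²`
  have hpt : ∀ x, (‖a x‖ * ‖fderiv ℝ v x‖) ^ 2 ≤ ∑ j, g j x ^ 2 := by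
    intro x
    have h1 : ‖fderiv ℝ v x‖ ^ 2 ≤ ∑ j, ‖vs j x‖ ^ 2 := by
      have := FluidPDE.sq_opNorm_le_frobeniusNormSq (fderiv ℝ v x)
      rwa [FluidPDE.frobeniusNormSq_eq_sum e] at this
    calc (‖a x‖ * ‖fderiv ℝ v x‖) ^ 2 = ‖a x‖ ^ 2 * ‖fderiv ℝ v x‖ ^ 2 := by ring
      _ ≤ ‖a x‖ ^ 2 * ∑ j, ‖vs j x‖ ^ 2 := mul_le_mul_of_nonneg_left h1 (sq_nonneg _)
      _ = ∑ j, g j x ^ 2 := by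
          rw [Finset.mul_sum]
          exact Finset.sum_congr rfl fun j _ => by rw [hg]; ring
  -- Step 2: `∫ gⱼ² ≤ (δK)² Rⱼ`, via Hölder and Sobolev in `ℝ≥0∞`
  have hstep : ∀ j, ∫ x, g j x ^ 2 ≤ (δ * K) ^ 2 * R j := by
    intro j
    -- `ofReal (∫ gⱼ²) = ‖gⱼ‖²_{L²}`
    have hL : ENNReal.ofReal (∫ x, g j x ^ 2) = eLpNorm (g j) 2 volume ^ 2 := by
      rw [ofReal_integral_eq_lintegral_ofReal (i_g2 j) (Eventually.of_forall fun x => sq_nonneg _),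
        ← lintegral_enorm_sq_eq_eLpNorm_two_sq]
      refine lintegral_congr fun x => ?_
      rw [Real.enorm_eq_ofReal (hg0 j x), ENNReal.ofReal_pow (hg0 j x)]
    -- Hölder `(3, 6, 2)`
    have hH : eLpNorm (g j) 2 volume ≤ eLpNorm a 3 volume * eLpNorm (vs j) 6 volume := by
      have := eLpNorm_le_eLpNorm_mul_eLpNorm_of_nnnorm (p := 3) (q := 6) (r := 2) ham
        (cvs j).aestronglyMeasurable (fun y z => ‖y‖ * ‖z‖) 1
        (Eventually.of_forall fun x => by simp) (μ := volume)
      simpa [hg] using this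
    -- Sobolev `‖∂ⱼv‖₆ ≤ K ‖D∂ⱼv‖₂`
    have hS : eLpNorm (vs j) 6 volume ≤ K * eLpNorm (fderiv ℝ (vs j)) 2 volume :=
      FluidPDE.eLpNorm_six_le_eLpNorm_fderiv_two volume finrank_euclideanSpace_fin (hvs1 j)
        (eLpNorm_two_lt_top_of_lintegral_enorm_sq_lt_top (l2vs j))
    -- `‖D∂ⱼv‖²_{L²} ≤ ofReal Rⱼ`
    have hD : eLpNorm (fderiv ℝ (vs j)) 2 volume ^ 2 ≤ ENNReal.ofReal (R j) := by
      rw [← lintegral_enorm_sq_eq_eLpNorm_two_sq, hRsum j,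
        ofReal_integral_eq_lintegral_ofReal (integrable_finsetSum _ fun i _ => i_dd j i)
          (Eventually.of_forall fun x => Finset.sum_nonneg fun i _ => sq_nonneg _)]
      refine lintegral_mono fun x => ?_
      rw [← ofReal_norm, ← ENNReal.ofReal_pow (norm_nonneg _)]
      exact ENNReal.ofReal_le_ofReal (FluidPDE.sq_opNorm_le_sum_sq_norm_apply e (fderiv ℝ (vs j) x))
    -- combine in `ℝ≥0∞`
    have hcomb : ENNReal.ofReal (∫ x, g j x ^ 2) ≤ ENNReal.ofReal ((δ * K) ^ 2 * R j) := by
      rw [hL]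
      calc eLpNorm (g j) 2 volume ^ 2
          ≤ (ENNReal.ofReal δ * (K * eLpNorm (fderiv ℝ (vs j)) 2 volume)) ^ 2 := by
            gcongr
            exact hH.trans (mul_le_mul' ha3 hS)
        _ = ENNReal.ofReal (δ ^ 2) * (K : ℝ≥0∞) ^ 2 * eLpNorm (fderiv ℝ (vs j)) 2 volume ^ 2 := by
            rw [ENNReal.ofReal_pow hδ0]; ring
        _ ≤ ENNReal.ofReal (δ ^ 2) * (K : ℝ≥0∞) ^ 2 * ENNReal.ofReal (R j) := by gcongr
        _ = ENNReal.ofReal ((δ * K) ^ 2 * R j) := by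
            rw [ENNReal.ofReal_mul (sq_nonneg _), mul_pow, ENNReal.ofReal_mul (sq_nonneg _),
              ENNReal.ofReal_pow K.coe_nonneg, ENNReal.ofReal_coe_nnreal]
    exact (ENNReal.ofReal_le_ofReal_iff (mul_nonneg (sq_nonneg _) (hR0 j))).1 hcomb
  -- Step 3: sum over `j`
  have hfin : ∫ x, (‖a x‖ * ‖fderiv ℝ v x‖) ^ 2 ≤ (δ * K) ^ 2 * ∑ j, R j :=
    calc ∫ x, (‖a x‖ * ‖fderiv ℝ v x‖) ^ 2 ≤ ∫ x, ∑ j, g j x ^ 2 := by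
          refine integral_mono_of_nonneg (Eventually.of_forall fun x => sq_nonneg _)
            (integrable_finsetSum _ fun j _ => i_g2 j) (Eventually.of_forall hpt)
      _ = ∑ j, ∫ x, g j x ^ 2 := integral_finsetSum _ fun j _ => i_g2 j
      _ ≤ ∑ j, (δ * K) ^ 2 * R j := Finset.sum_le_sum fun j _ => hstep j
      _ = (δ * K) ^ 2 * ∑ j, R j := by rw [← Finset.mul_sum]
  rw [hHess] at hfin
  exact hfin

end KeyEstimate


/-! ### The enstrophy production at a fixed time, under the splitting -/

section Slice

/-- **The enstrophy production bound under an `L³`-small plus bounded splitting** (the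
computation of Lemarié-Rieusset 2016, (11.9), with von Wahl's splitting, Prop. 12.3). Let
`v : ℝ³ → ℝ³` be `C³` and divergence free, `W : ℝ³ → ℝ³` and `q : ℝ³ → ℝ` be `C¹`, with the
momentum equation `W + (v·∇)v = νΔv - ∇q` (so `W = ∂ₜu`, `v = u(t)`, `q = p(t)` for a classical
solution), `v` bounded, `Dv, D²v, D³v, W, DW, q, Dq ∈ L²`. Suppose `v = (v - b) + b` with `b`
measurable, `|b| ≤ M`, `‖v - b‖_{L³} ≤ δ` and `2 (δK)² ≤ ν²` (`K` the Sobolev constant of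
`‖w‖_{L⁶} ≤ K‖Dw‖_{L²}`). Then
`∫ Σᵢ ⟪∂ᵢv, ∂ᵢW⟫ ≤ (M²/ν) ∫ |∇v|²`.
Proof: `∫ Σᵢ ⟪∂ᵢv, ∂ᵢW⟫ = -∫ ⟪Δv, W⟫ = -ν‖Δv‖²₂ + ∫ ⟪Δv, (v·∇)v⟫ + ∫ ⟪Δv, ∇q⟫`; the pressure
term vanishes (`div Δv = 0`); `|⟪Δv, (v·∇)v⟫| ≤ |Δv| (|v - b| + M) ‖Dv‖ ≤ (ν/2)|Δv|² +
ν⁻¹ |v - b|² ‖Dv‖² + ν⁻¹ M² ‖Dv‖²`, and `∫ |v - b|² ‖Dv‖² ≤ (δK)² ∫ |Δv|²`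
(`integral_sq_norm_mul_norm_fderiv_le_of_eLpNorm_three_le`), which is absorbed.
[cite: LemarieRieusset2016, Thm. 11.2 (11.9) with Prop. 12.3] -/
theorem integral_sum_inner_fderiv_le_of_momentum_of_split {ν : ℝ} (hν : 0 < ν)
    {v W : EuclideanSpace ℝ (Fin 3) → EuclideanSpace ℝ (Fin 3)} {q : EuclideanSpace ℝ (Fin 3) → ℝ}
    (hv : ContDiff ℝ 3 v) (hW : ContDiff ℝ 1 W) (hq : ContDiff ℝ 1 q)
    (hmom : ∀ x, W x + FluidPDE.convect v v x = ν • (Δ v) x - gradient q x)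
    (hdiv : VectorCalculus.IsDivFree v) {B : ℝ} (hB : ∀ x, ‖v x‖ ≤ B)
    {b : EuclideanSpace ℝ (Fin 3) → EuclideanSpace ℝ (Fin 3)} (hbm : AEStronglyMeasurable b volume)
    {M : ℝ} (hbM : ∀ x, ‖b x‖ ≤ M) {δ : ℝ} (hδ0 : 0 ≤ δ)
    (ha3 : eLpNorm (fun x => v x - b x) 3 volume ≤ ENNReal.ofReal δ)
    (hδ : 2 * (δ * (SNormLESNormFDerivOfEqConst (EuclideanSpace ℝ (Fin 3))
        (volume : Measure (EuclideanSpace ℝ (Fin 3))) 2 : ℝ)) ^ 2 ≤ ν ^ 2)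
    (hv1 : ∫⁻ x, ‖iteratedFDeriv ℝ 1 v x‖ₑ ^ 2 < ⊤) (hv2 : ∫⁻ x, ‖iteratedFDeriv ℝ 2 v x‖ₑ ^ 2 < ⊤)
    (hv3 : ∫⁻ x, ‖iteratedFDeriv ℝ 3 v x‖ₑ ^ 2 < ⊤)
    (hW0 : ∫⁻ x, ‖W x‖ₑ ^ 2 < ⊤) (hW1 : ∫⁻ x, ‖iteratedFDeriv ℝ 1 W x‖ₑ ^ 2 < ⊤)
    (hq0 : ∫⁻ x, ‖q x‖ₑ ^ 2 < ⊤) (hq1 : ∫⁻ x, ‖iteratedFDeriv ℝ 1 q x‖ₑ ^ 2 < ⊤) :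
    ∫ x, ∑ i, ⟪fderiv ℝ v x (EuclideanSpace.basisFun (Fin 3) ℝ i),
        fderiv ℝ W x (EuclideanSpace.basisFun (Fin 3) ℝ i)⟫ ≤
      M ^ 2 / ν * ∫ x, FluidPDE.frobeniusNormSq (fderiv ℝ v x) := by
  set e := EuclideanSpace.basisFun (Fin 3) ℝ with he
  have he1 : ∀ i, ‖e i‖ = 1 := fun i => by simp [he]
  set K : ℝ≥0 := SNormLESNormFDerivOfEqConst (EuclideanSpace ℝ (Fin 3))
    (volume : Measure (EuclideanSpace ℝ (Fin 3))) 2 with hK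
  set a : EuclideanSpace ℝ (Fin 3) → EuclideanSpace ℝ (Fin 3) := fun x => v x - b x with ha_def
  have hM0 : 0 ≤ M := (norm_nonneg _).trans (hbM 0)
  have hB0 : 0 ≤ B := (norm_nonneg _).trans (hB 0)
  have hν' : 0 < ν⁻¹ := inv_pos.2 hν
  -- smoothness and continuity
  have hv2' : ContDiff ℝ 2 v := hv.of_le (by norm_num)
  have hv1' : ContDiff ℝ 1 v := hv.of_le (by norm_num)
  have hΔ1 : ContDiff ℝ 1 (Δ v) := contDiff_one_laplacian_of_contDiff_three hv
  have cv : Continuous v := hv.continuous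
  have cDv : Continuous (fderiv ℝ v) := hv.continuous_fderiv (by norm_num)
  have cD1 : Continuous fun x => iteratedFDeriv ℝ 1 v x := hv.continuous_iteratedFDeriv (by norm_num)
  have cD2 : Continuous fun x => iteratedFDeriv ℝ 2 v x := hv.continuous_iteratedFDeriv (by norm_num)
  have cD3 : Continuous fun x => iteratedFDeriv ℝ 3 v x := hv.continuous_iteratedFDeriv (by norm_num)
  have cdiv : ∀ i, Continuous fun x => fderiv ℝ v x (e i) := fun i => cDv.clm_apply continuous_const
  have cddv : ∀ i, Continuous fun x => fderiv ℝ (fun y => fderiv ℝ v y (e i)) x (e i) := fun i =>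
    ((((hv.fderiv_right (m := 2) (by norm_num)).clm_apply contDiff_const).continuous_fderiv
      (by norm_num)).clm_apply continuous_const)
  have cW : Continuous W := hW.continuous
  have cDW : Continuous (fderiv ℝ W) := hW.continuous_fderiv one_ne_zero
  have cdiW : ∀ i, Continuous fun x => fderiv ℝ W x (e i) := fun i => cDW.clm_apply continuous_const
  have cq : Continuous q := hq.continuous
  have cDq : Continuous (fderiv ℝ q) := hq.continuous_fderiv one_ne_zero
  have cdiq : ∀ i, Continuous fun x => fderiv ℝ q x (e i) := fun i => cDq.clm_apply continuous_const
  have cgq : Continuous (gradient q) := by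
    have : gradient q = fun x => (InnerProductSpace.toDual ℝ _).symm (fderiv ℝ q x) := rfl
    rw [this]
    exact (InnerProductSpace.toDual ℝ (EuclideanSpace ℝ (Fin 3))).symm.continuous.comp cDq
  have cΔ : Continuous (Δ v) := hΔ1.continuous
  have cdΔ : ∀ i, Continuous fun x => fderiv ℝ (Δ v) x (e i) := fun i =>
    (hΔ1.continuous_fderiv one_ne_zero).clm_apply continuous_const
  have cconv : Continuous (FluidPDE.convect v v) := cDv.clm_apply cv
  have c3D2 : Continuous fun x => (3 : ℝ) • iteratedFDeriv ℝ 2 v x := cD2.const_smul (3 : ℝ)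
  have c3D3 : Continuous fun x => (3 : ℝ) • iteratedFDeriv ℝ 3 v x := cD3.const_smul (3 : ℝ)
  have cBDv : Continuous fun x => B • fderiv ℝ v x := cDv.const_smul B
  -- pointwise norm bounds
  have hDv_eq : ∀ x, ‖fderiv ℝ v x‖ = ‖iteratedFDeriv ℝ 1 v x‖ := fun x => by
    rw [← norm_iteratedFDeriv_fderiv, norm_iteratedFDeriv_zero]
  have n_Δ : ∀ x, ‖(Δ v) x‖ ≤ ‖(3 : ℝ) • iteratedFDeriv ℝ 2 v x‖ := fun x => by
    rw [norm_smul, Real.norm_of_nonneg (by norm_num : (0 : ℝ) ≤ 3)]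
    exact norm_laplacian_le_three_mul_norm_iteratedFDeriv_two hv2' x
  have n_dΔ : ∀ i x, ‖fderiv ℝ (Δ v) x (e i)‖ ≤ ‖(3 : ℝ) • iteratedFDeriv ℝ 3 v x‖ := fun i x => by
    rw [norm_smul, Real.norm_of_nonneg (by norm_num : (0 : ℝ) ≤ 3),
      fderiv_laplacian_apply_of_contDiff_three hv x (e i)]
    exact (norm_laplacian_le_three_mul_norm_iteratedFDeriv_two
      ((hv.fderiv_right (m := 2) (by norm_num)).clm_apply contDiff_const) x).trans
      (mul_le_mul_of_nonneg_left (norm_iteratedFDeriv_fderiv_apply_basisFun_le hv 2 (by norm_num) x i)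
        (by norm_num))
  have n_conv : ∀ x, ‖FluidPDE.convect v v x‖ ≤ ‖B • fderiv ℝ v x‖ := fun x => by
    rw [FluidPDE.convect, norm_smul, Real.norm_of_nonneg hB0, mul_comm]
    exact (fderiv ℝ v x).le_opNorm_of_le (hB x)
  have n_gq : ∀ x, ‖gradient q x‖ = ‖iteratedFDeriv ℝ 1 q x‖ := fun x => by
    rw [gradient, LinearIsometryEquiv.norm_map, ← norm_iteratedFDeriv_fderiv, norm_iteratedFDeriv_zero]
  have hin : ∀ i (y : EuclideanSpace ℝ (Fin 3)), ‖⟪e i, y⟫‖ ≤ ‖y‖ := fun i y =>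
    (norm_inner_le_norm (𝕜 := ℝ) (e i) y).trans (by rw [he1, one_mul])
  -- finite `L²` norms
  have l2Dv : ∫⁻ x, ‖fderiv ℝ v x‖ₑ ^ 2 < ⊤ :=
    lintegral_enorm_sq_lt_top_of_norm_le (fun x => (hDv_eq x).le) hv1
  have l2Δ : ∫⁻ x, ‖(3 : ℝ) • iteratedFDeriv ℝ 2 v x‖ₑ ^ 2 < ⊤ := by
    have : ∀ x, ‖(3 : ℝ) • iteratedFDeriv ℝ 2 v x‖ₑ ^ 2 =
        ENNReal.ofReal (3 ^ 2) * ‖iteratedFDeriv ℝ 2 v x‖ₑ ^ 2 := by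
      intro x
      rw [enorm_smul, mul_pow, Real.enorm_eq_ofReal (by norm_num : (0:ℝ) ≤ 3),
        ENNReal.ofReal_pow (by norm_num : (0:ℝ) ≤ 3)]
    simp_rw [this]
    rw [lintegral_const_mul' _ _ ENNReal.ofReal_ne_top]
    exact ENNReal.mul_lt_top ENNReal.ofReal_lt_top hv2
  have l2dΔ : ∫⁻ x, ‖(3 : ℝ) • iteratedFDeriv ℝ 3 v x‖ₑ ^ 2 < ⊤ := by
    have : ∀ x, ‖(3 : ℝ) • iteratedFDeriv ℝ 3 v x‖ₑ ^ 2 =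
        ENNReal.ofReal (3 ^ 2) * ‖iteratedFDeriv ℝ 3 v x‖ₑ ^ 2 := by
      intro x
      rw [enorm_smul, mul_pow, Real.enorm_eq_ofReal (by norm_num : (0:ℝ) ≤ 3),
        ENNReal.ofReal_pow (by norm_num : (0:ℝ) ≤ 3)]
    simp_rw [this]
    rw [lintegral_const_mul' _ _ ENNReal.ofReal_ne_top]
    exact ENNReal.mul_lt_top ENNReal.ofReal_lt_top hv3
  have l2BDv : ∫⁻ x, ‖B • fderiv ℝ v x‖ₑ ^ 2 < ⊤ := by
    have : ∀ x, ‖B • fderiv ℝ v x‖ₑ ^ 2 = ENNReal.ofReal (B ^ 2) * ‖fderiv ℝ v x‖ₑ ^ 2 := by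
      intro x
      rw [enorm_smul, mul_pow, Real.enorm_eq_ofReal hB0, ENNReal.ofReal_pow hB0]
    simp_rw [this]
    rw [lintegral_const_mul' _ _ ENNReal.ofReal_ne_top]
    exact ENNReal.mul_lt_top ENNReal.ofReal_lt_top l2Dv
  have l2gq : ∫⁻ x, ‖gradient q x‖ₑ ^ 2 < ⊤ :=
    lintegral_enorm_sq_lt_top_of_norm_le (fun x => (n_gq x).le) hq1
  have l2diq : ∀ i, ∫⁻ x, ‖fderiv ℝ q x (e i)‖ₑ ^ 2 < ⊤ := fun i =>
    lintegral_enorm_sq_lt_top_of_norm_le (fun x => norm_fderiv_apply_basisFun_le q x i) hq1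
  have l2ddv : ∀ i, ∫⁻ x, ‖fderiv ℝ (fun y => fderiv ℝ v y (e i)) x (e i)‖ₑ ^ 2 < ⊤ := fun i =>
    lintegral_enorm_sq_lt_top_of_norm_le (fun x => norm_fderiv_fderiv_apply_basisFun_le hv2' x i) hv2
  have l2div : ∀ i, ∫⁻ x, ‖fderiv ℝ v x (e i)‖ₑ ^ 2 < ⊤ := fun i =>
    lintegral_enorm_sq_lt_top_of_norm_le (fun x => by
      simpa [he1] using (fderiv ℝ v x).le_opNorm (e i)) l2Dv
  have l2diW : ∀ i, ∫⁻ x, ‖fderiv ℝ W x (e i)‖ₑ ^ 2 < ⊤ := fun i =>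
    lintegral_enorm_sq_lt_top_of_norm_le (fun x => norm_fderiv_apply_basisFun_le W x i) hW1
  -- integrability of the products
  have i1 : ∀ i, Integrable (fun x => ⟪fderiv ℝ (fun y => fderiv ℝ v y (e i)) x (e i), W x⟫)
      volume := fun i =>
    integrable_of_norm_le_mul_of_lintegral_sq ((cddv i).inner cW).aestronglyMeasurable (cddv i) cW
      (l2ddv i) hW0 fun x => norm_inner_le_norm _ _
  have i2 : ∀ i, Integrable (fun x => ⟪fderiv ℝ v x (e i), fderiv ℝ W x (e i)⟫) volume := fun i =>
    integrable_of_norm_le_mul_of_lintegral_sq ((cdiv i).inner (cdiW i)).aestronglyMeasurable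
      (cdiv i) (cdiW i) (l2div i) (l2diW i) fun x => norm_inner_le_norm _ _
  have i3 : ∀ i, Integrable (fun x => ⟪fderiv ℝ v x (e i), W x⟫) volume := fun i =>
    integrable_of_norm_le_mul_of_lintegral_sq ((cdiv i).inner cW).aestronglyMeasurable (cdiv i) cW
      (l2div i) hW0 fun x => norm_inner_le_norm _ _
  have iΔΔ : Integrable (fun x => ‖(Δ v) x‖ ^ 2) volume :=
    FluidPDE.integrable_sq_norm_of_lintegral_lt_top cΔ (lintegral_enorm_sq_lt_top_of_norm_le n_Δ l2Δ)
  have iΔN : Integrable (fun x => ⟪(Δ v) x, FluidPDE.convect v v x⟫) volume :=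
    integrable_of_norm_le_mul_of_lintegral_sq (cΔ.inner cconv).aestronglyMeasurable c3D2 cBDv
      l2Δ l2BDv fun x => (norm_inner_le_norm _ _).trans
        (mul_le_mul (n_Δ x) (n_conv x) (norm_nonneg _) (norm_nonneg _))
  have iΔg : Integrable (fun x => ⟪(Δ v) x, gradient q x⟫) volume :=
    integrable_of_norm_le_mul_of_lintegral_sq (cΔ.inner cgq).aestronglyMeasurable c3D2 cgq
      l2Δ l2gq fun x => (norm_inner_le_norm _ _).trans
        (mul_le_mul_of_nonneg_right (n_Δ x) (norm_nonneg _))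
  have iDv : Integrable (fun x => ‖fderiv ℝ v x‖ ^ 2) volume :=
    FluidPDE.integrable_sq_norm_of_lintegral_lt_top cDv l2Dv
  have lfrob : ∫⁻ x, ENNReal.ofReal (FluidPDE.frobeniusNormSq (fderiv ℝ v x)) < ⊤ :=
    calc ∫⁻ x, ENNReal.ofReal (FluidPDE.frobeniusNormSq (fderiv ℝ v x))
        ≤ ∫⁻ x, 3 * ‖fderiv ℝ v x‖ₑ ^ 2 :=
          lintegral_mono fun x => ofReal_frobeniusNormSq_le_three_mul_enorm_sq _
      _ = 3 * ∫⁻ x, ‖fderiv ℝ v x‖ₑ ^ 2 := lintegral_const_mul' _ _ (by norm_num)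
      _ < ⊤ := ENNReal.mul_lt_top (by norm_num) l2Dv
  have ifrob : Integrable (fun x => FluidPDE.frobeniusNormSq (fderiv ℝ v x)) volume :=
    integrable_of_continuous_of_nonneg (FluidPDE.continuous_frobeniusNormSq_fderiv hv (by simp))
      (fun x => FluidPDE.frobeniusNormSq_nonneg _) lfrob
  -- the `L³`-small part `a = v - b`
  have ham : AEStronglyMeasurable a volume := cv.aestronglyMeasurable.sub hbm
  have haC : ∀ x, ‖a x‖ ≤ B + M := fun x =>
    (norm_sub_le _ _).trans (add_le_add (hB x) (hbM x))
  have iaDv : Integrable (fun x => (‖a x‖ * ‖fderiv ℝ v x‖) ^ 2) volume := by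
    have hdom : Integrable (fun x => (B + M) ^ 2 * ‖fderiv ℝ v x‖ ^ 2) volume := iDv.const_mul _
    refine hdom.mono' ((ham.norm.mul cDv.norm.aestronglyMeasurable).pow 2)
      (Eventually.of_forall fun x => ?_)
    rw [Real.norm_of_nonneg (sq_nonneg _), mul_pow]
    exact mul_le_mul_of_nonneg_right
      (pow_le_pow_left₀ (norm_nonneg _) (haC x) 2) (sq_nonneg _)
  -- Step 1: `∫ Σᵢ ⟪∂ᵢv, ∂ᵢW⟫ = -∫ ⟪Δv, W⟫`
  have hL := integral_sum_inner_fderiv_fderiv_eq_neg_integral_inner_laplacian hv2' hW i1 i2 i3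
  -- Step 2: the pressure term vanishes, `∫ ⟪Δv, ∇q⟫ = 0`
  have hpress : ∫ x, ⟪(Δ v) x, gradient q x⟫ = 0 := by
    have hswap : (fun x => ⟪(Δ v) x, gradient q x⟫) = fun x => ⟪gradient q x, (Δ v) x⟫ :=
      funext fun x => real_inner_comm _ _
    rw [hswap]
    refine integral_inner_gradient_eq_zero_of_isDivFree_R3 hq hΔ1
      (isDivFree_laplacian_of_contDiff_three hv hdiv) (fun i => ?_) (fun i => ?_) (fun i => ?_)
    · refine integrable_of_norm_le_mul_of_lintegral_sq
        ((continuous_const.inner cΔ).mul (cdiq i)).aestronglyMeasurable c3D2 (cdiq i) l2Δ (l2diq i)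
        fun x => ?_
      rw [norm_mul]
      exact mul_le_mul ((hin i _).trans (n_Δ x)) le_rfl (norm_nonneg _) (norm_nonneg _)
    · refine integrable_of_norm_le_mul_of_lintegral_sq
        ((continuous_const.inner (cdΔ i)).mul cq).aestronglyMeasurable c3D3 cq l2dΔ hq0
        fun x => ?_
      rw [norm_mul]
      exact mul_le_mul ((hin i _).trans (n_dΔ i x)) le_rfl (norm_nonneg _) (norm_nonneg _)
    · refine integrable_of_norm_le_mul_of_lintegral_sq
        ((continuous_const.inner cΔ).mul cq).aestronglyMeasurable c3D2 cq l2Δ hq0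
        fun x => ?_
      rw [norm_mul]
      exact mul_le_mul ((hin i _).trans (n_Δ x)) le_rfl (norm_nonneg _) (norm_nonneg _)
  -- Step 3: the pointwise bound
  have hpt : ∀ x, -⟪(Δ v) x, W x⟫ ≤
      -(ν / 2) * ‖(Δ v) x‖ ^ 2 + ν⁻¹ * (‖a x‖ * ‖fderiv ℝ v x‖) ^ 2 +
        ν⁻¹ * M ^ 2 * ‖fderiv ℝ v x‖ ^ 2 + ⟪(Δ v) x, gradient q x⟫ := by
    intro x
    -- `W = νΔv - (v·∇)v - ∇q`
    have hWx : W x = ν • (Δ v) x - FluidPDE.convect v v x - gradient q x := by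
      have h : W x = ν • (Δ v) x - gradient q x - FluidPDE.convect v v x :=
        eq_sub_iff_add_eq.2 (hmom x)
      rw [h]; abel
    have hid : ⟪(Δ v) x, W x⟫ = ν * ‖(Δ v) x‖ ^ 2 - ⟪(Δ v) x, FluidPDE.convect v v x⟫ -
        ⟪(Δ v) x, gradient q x⟫ := by
      rw [hWx, inner_sub_right, inner_sub_right, inner_smul_right, real_inner_self_eq_norm_sq]
    -- `|(v·∇)v| ≤ |a| ‖Dv‖ + M ‖Dv‖`
    have hN : ‖FluidPDE.convect v v x‖ ≤ ‖a x‖ * ‖fderiv ℝ v x‖ + M * ‖fderiv ℝ v x‖ := by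
      have hvx : v x = a x + b x := by simp [ha_def]
      rw [FluidPDE.convect, hvx, map_add]
      refine (norm_add_le _ _).trans (add_le_add ?_ ?_)
      · rw [mul_comm]; exact (fderiv ℝ v x).le_opNorm _
      · rw [mul_comm]; exact (fderiv ℝ v x).le_opNorm_of_le (hbM x)
    have hinner : ⟪(Δ v) x, FluidPDE.convect v v x⟫ ≤
        ‖(Δ v) x‖ * (‖a x‖ * ‖fderiv ℝ v x‖ + M * ‖fderiv ℝ v x‖) :=
      (real_inner_le_norm _ _).trans (mul_le_mul_of_nonneg_left hN (norm_nonneg _))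
    -- absorb with `XY ≤ (ν/4)X² + ν⁻¹Y²`
    have habs : ∀ X Y : ℝ, X * Y ≤ ν / 4 * X ^ 2 + ν⁻¹ * Y ^ 2 := by
      intro X Y
      have h1 : 0 ≤ ν⁻¹ * (Y - ν / 2 * X) ^ 2 := by positivity
      have e1 : ν⁻¹ * (Y - ν / 2 * X) ^ 2 = ν⁻¹ * Y ^ 2 - X * Y + ν / 4 * X ^ 2 := by
        field_simp
        ring
      linarith
    have hP := habs ‖(Δ v) x‖ (‖a x‖ * ‖fderiv ℝ v x‖)
    have hQ := habs ‖(Δ v) x‖ (M * ‖fderiv ℝ v x‖)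
    have hQ2 : ν⁻¹ * (M * ‖fderiv ℝ v x‖) ^ 2 = ν⁻¹ * M ^ 2 * ‖fderiv ℝ v x‖ ^ 2 := by ring
    have hdist : ‖(Δ v) x‖ * (‖a x‖ * ‖fderiv ℝ v x‖ + M * ‖fderiv ℝ v x‖) =
        ‖(Δ v) x‖ * (‖a x‖ * ‖fderiv ℝ v x‖) + ‖(Δ v) x‖ * (M * ‖fderiv ℝ v x‖) := mul_add _ _ _
    rw [hid]
    linarith [hinner, hP, hQ, hQ2, hdist]
  -- Step 4: integrate the pointwise bound
  have iA : Integrable (fun x => -(ν / 2) * ‖(Δ v) x‖ ^ 2) volume := iΔΔ.const_mul _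
  have iB' : Integrable (fun x => ν⁻¹ * (‖a x‖ * ‖fderiv ℝ v x‖) ^ 2) volume := iaDv.const_mul _
  have iC : Integrable (fun x => ν⁻¹ * M ^ 2 * ‖fderiv ℝ v x‖ ^ 2) volume := iDv.const_mul _
  have iAB : Integrable (fun x => -(ν / 2) * ‖(Δ v) x‖ ^ 2 +
      ν⁻¹ * (‖a x‖ * ‖fderiv ℝ v x‖) ^ 2) volume := iA.add iB'
  have iABC : Integrable (fun x => -(ν / 2) * ‖(Δ v) x‖ ^ 2 +
      ν⁻¹ * (‖a x‖ * ‖fderiv ℝ v x‖) ^ 2 + ν⁻¹ * M ^ 2 * ‖fderiv ℝ v x‖ ^ 2) volume := iAB.add iC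
  have irhs : Integrable (fun x => -(ν / 2) * ‖(Δ v) x‖ ^ 2 + ν⁻¹ * (‖a x‖ * ‖fderiv ℝ v x‖) ^ 2 +
      ν⁻¹ * M ^ 2 * ‖fderiv ℝ v x‖ ^ 2 + ⟪(Δ v) x, gradient q x⟫) volume := iABC.add iΔg
  have iΔW : Integrable (fun x => ⟪(Δ v) x, W x⟫) volume :=
    integrable_of_norm_le_mul_of_lintegral_sq (cΔ.inner cW).aestronglyMeasurable c3D2 cW l2Δ hW0
      fun x => (norm_inner_le_norm _ _).trans (mul_le_mul_of_nonneg_right (n_Δ x) (norm_nonneg _))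
  have hint : ∫ x, -⟪(Δ v) x, W x⟫ ≤
      -(ν / 2) * (∫ x, ‖(Δ v) x‖ ^ 2) + ν⁻¹ * (∫ x, (‖a x‖ * ‖fderiv ℝ v x‖) ^ 2) +
        ν⁻¹ * M ^ 2 * (∫ x, ‖fderiv ℝ v x‖ ^ 2) + ∫ x, ⟪(Δ v) x, gradient q x⟫ := by
    refine (integral_mono iΔW.neg irhs hpt).trans (le_of_eq ?_)
    rw [integral_add iABC iΔg, integral_add iAB iC, integral_add iA iB', integral_const_mul,
      integral_const_mul, integral_const_mul]
  -- Step 5: the key estimate and the absorption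
  have hE1 := integral_sq_norm_mul_norm_fderiv_le_of_eLpNorm_three_le hv hv1 hv2 hv3 ham haC hδ0 ha3
  have hL2 : 0 ≤ ∫ x, ‖(Δ v) x‖ ^ 2 := integral_nonneg fun x => sq_nonneg _
  have hDfrob : ∫ x, ‖fderiv ℝ v x‖ ^ 2 ≤ ∫ x, FluidPDE.frobeniusNormSq (fderiv ℝ v x) :=
    integral_mono iDv ifrob fun x => FluidPDE.sq_opNorm_le_frobeniusNormSq _
  have hfrob0 : 0 ≤ ∫ x, FluidPDE.frobeniusNormSq (fderiv ℝ v x) :=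
    integral_nonneg fun x => FluidPDE.frobeniusNormSq_nonneg _
  have hcoef : ν⁻¹ * (δ * K) ^ 2 ≤ ν / 2 := by
    rw [inv_mul_le_iff₀ hν]
    nlinarith [hδ]
  have hneg_int : ∫ x, -⟪(Δ v) x, W x⟫ = - ∫ x, ⟪(Δ v) x, W x⟫ := integral_neg _
  rw [hL, ← hneg_int]
  -- linear bookkeeping with the integrals as atoms
  set L := ∫ x, ‖(Δ v) x‖ ^ 2 with hLdef
  set Pint := ∫ x, (‖a x‖ * ‖fderiv ℝ v x‖) ^ 2 with hPdef
  set Dint := ∫ x, ‖fderiv ℝ v x‖ ^ 2 with hDdef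
  set Fint := ∫ x, FluidPDE.frobeniusNormSq (fderiv ℝ v x) with hFdef
  set Gint := ∫ x, ⟪(Δ v) x, gradient q x⟫ with hGdef
  have h1 : ν⁻¹ * Pint ≤ ν⁻¹ * ((δ * K) ^ 2 * L) := mul_le_mul_of_nonneg_left hE1 hν'.le
  have h2 : ν⁻¹ * M ^ 2 * Dint ≤ ν⁻¹ * M ^ 2 * Fint :=
    mul_le_mul_of_nonneg_left hDfrob (by positivity)
  have h3 : ν⁻¹ * ((δ * K) ^ 2 * L) ≤ ν / 2 * L := by
    rw [← mul_assoc]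
    exact mul_le_mul_of_nonneg_right hcoef hL2
  have h4 : ν⁻¹ * M ^ 2 * Fint = M ^ 2 / ν * Fint := by ring
  linarith [hint, h1, h2, h3, h4, hpress]

end Slice


/-! ### The enstrophy inequality on a slab, under the splitting -/

section Slab

/-- **The enstrophy inequality under an `L³`-small plus bounded splitting** (von Wahl's
regularity class `C([0,T]; L³)`, Lemarié-Rieusset 2016, Prop. 12.3, combined with the enstrophy
computation of Thm. 11.2 / (11.9)). Let `(u, p)` be a classical solution of the unforced
Navier–Stokes system with viscosity `ν > 0` on the closed slab `[0, T] × ℝ³` such that `u`, `∂ₜu`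
(the one-sided time derivative within `[0, T]`) and `p` have all `L²` Sobolev norms bounded on
`[0, T]` (the class of Tao 2013, Thm. 5.4 (iv)). Suppose that on `[0, s]`, `0 < s ≤ T`, the
velocity splits as `u(t) = (u(t) - b(t)) + b(t)` with `b(t)` measurable, `|b(t)| ≤ M` (`M > 0`)
and `‖u(t) - b(t)‖_{L³} ≤ δ`, where `2 (δK)² ≤ ν²` (`K` the Sobolev constant of
`‖w‖_{L⁶} ≤ K ‖Dw‖_{L²}`, Mathlib `SNormLESNormFDerivOfEqConst`). Then
`∫ |∇u(s)|² ≤ exp (2 M² s / ν) ∫ |∇u(0)|²`.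
Proof: as for `lintegral_frobeniusNormSq_fderiv_le_mul_exp` (`G(b) - G(0) = ∫₀ᵇ 2∫Σᵢ⟪∂ᵢu, ∂ᵢ∂ₜu⟫`
by the pointwise derivative and Fubini), with the slice bound
`integral_sum_inner_fderiv_le_of_momentum_of_split` (`≤ (M²/ν) G(t)`) and Grönwall's lemma.
[cite: LemarieRieusset2016, Prop. 12.3 with Thm. 11.2 (11.9)–(11.11)] -/
theorem lintegral_frobeniusNormSq_fderiv_le_mul_exp_of_split {ν T : ℝ} (hν : 0 < ν) (hT : 0 < T)
    {u : ℝ → EuclideanSpace ℝ (Fin 3) → EuclideanSpace ℝ (Fin 3)}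
    {p : ℝ → EuclideanSpace ℝ (Fin 3) → ℝ} (hsol : FluidPDE.IsClassicalNSSolutionOn (Icc 0 T) ν 0 u p)
    (hu : HasBoundedSobolevNormsOn (Icc 0 T) u)
    (hut : HasBoundedSobolevNormsOn (Icc 0 T) (FluidPDE.timeDerivWithin (Icc 0 T) u))
    (hp : ∀ n : ℕ, ∃ C : ℝ≥0, ∀ t ∈ Icc 0 T, ∫⁻ x, ‖iteratedFDeriv ℝ n (p t) x‖ₑ ^ 2 ≤ C)
    {M s : ℝ} (hM0 : 0 < M) (hs : s ∈ Ioc 0 T)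
    (b : ℝ → EuclideanSpace ℝ (Fin 3) → EuclideanSpace ℝ (Fin 3))
    (hbm : ∀ t ∈ Icc 0 s, AEStronglyMeasurable (b t) volume)
    (hbM : ∀ t ∈ Icc 0 s, ∀ x, ‖b t x‖ ≤ M) {δ : ℝ} (hδ0 : 0 ≤ δ)
    (hsmall : ∀ t ∈ Icc 0 s, eLpNorm (fun x => u t x - b t x) 3 volume ≤ ENNReal.ofReal δ)
    (hδ : 2 * (δ * (SNormLESNormFDerivOfEqConst (EuclideanSpace ℝ (Fin 3))
        (volume : Measure (EuclideanSpace ℝ (Fin 3))) 2 : ℝ)) ^ 2 ≤ ν ^ 2) :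
    ∫⁻ x, ENNReal.ofReal (FluidPDE.frobeniusNormSq (fderiv ℝ (u s) x)) ≤
      ENNReal.ofReal (Real.exp (2 * M ^ 2 * s / ν)) *
        ∫⁻ x, ENNReal.ofReal (FluidPDE.frobeniusNormSq (fderiv ℝ (u 0) x)) := by
  -- a pointwise bound on `u` over the slab (Sobolev), used only for integrability
  obtain ⟨B₀, hB₀⟩ := linfty_bound_of_hasBoundedSobolevNormsOn_holds
    (fun t ht => (hsol.contDiff_velocity ht).of_le (by norm_cast)) hu
  set e := EuclideanSpace.basisFun (Fin 3) ℝ with he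
  have hU : UniqueDiffOn ℝ (Icc 0 T) := uniqueDiffOn_Icc hT
  set W : ℝ → EuclideanSpace ℝ (Fin 3) → EuclideanSpace ℝ (Fin 3) :=
    FluidPDE.timeDerivWithin (Icc 0 T) u with hW
  have hWsm : FluidPDE.IsSmoothSpaceTimeOn (Icc 0 T) W := hsol.smooth_velocity.timeDerivWithin hU
  -- joint continuity of `D(u t)(x)` and `D(W t)(x)`
  have cDu : ContinuousOn (fun z : ℝ × EuclideanSpace ℝ (Fin 3) => fderiv ℝ (u z.1) z.2)
      (Icc 0 T ×ˢ univ) := hsol.smooth_velocity.continuousOn_fderiv_slice hU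
  have cDW : ContinuousOn (fun z : ℝ × EuclideanSpace ℝ (Fin 3) => fderiv ℝ (W z.1) z.2)
      (Icc 0 T ×ˢ univ) := hWsm.continuousOn_fderiv_slice hU
  -- the density `g t x = Σᵢ ⟪∂ᵢu, ∂ᵢW⟫` and the enstrophy `G t = ∫ |∇u(t)|²`
  set g : ℝ → EuclideanSpace ℝ (Fin 3) → ℝ := fun t x =>
    ∑ i, ⟪fderiv ℝ (u t) x (e i), fderiv ℝ (W t) x (e i)⟫ with hg
  set G : ℝ → ℝ := fun t => ∫ x, FluidPDE.frobeniusNormSq (fderiv ℝ (u t) x) with hG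
  have cg : ContinuousOn (uncurry g) (Icc 0 T ×ˢ univ) := by
    refine continuousOn_finsetSum _ fun i _ => ContinuousOn.inner ?_ ?_
    · exact cDu.clm_apply continuousOn_const
    · exact cDW.clm_apply continuousOn_const
  have cfrob : ContinuousOn (fun z : ℝ × EuclideanSpace ℝ (Fin 3) =>
      FluidPDE.frobeniusNormSq (fderiv ℝ (u z.1) z.2)) (Icc 0 T ×ˢ univ) :=
    continuous_frobeniusNormSq_clm.comp_continuousOn cDu
  -- uniform `L²` bounds
  obtain ⟨C₁, hC₁⟩ := hu 1
  obtain ⟨C₂, hC₂⟩ := hut 1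
  have hfrob_le : ∀ t ∈ Icc 0 T,
      ∫⁻ x, ENNReal.ofReal (FluidPDE.frobeniusNormSq (fderiv ℝ (u t) x)) ≤ 3 * C₁ := by
    intro t ht
    calc ∫⁻ x, ENNReal.ofReal (FluidPDE.frobeniusNormSq (fderiv ℝ (u t) x))
        ≤ ∫⁻ x, 3 * ‖iteratedFDeriv ℝ 1 (u t) x‖ₑ ^ 2 := lintegral_mono fun x => by
          rw [← ofReal_norm, norm_iteratedFDeriv_one, ofReal_norm]
          exact ofReal_frobeniusNormSq_le_three_mul_enorm_sq _
      _ = 3 * ∫⁻ x, ‖iteratedFDeriv ℝ 1 (u t) x‖ₑ ^ 2 := lintegral_const_mul' _ _ (by norm_num)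
      _ ≤ 3 * C₁ := by gcongr; exact hC₁ t ht
  have hfrob_lt : ∀ t ∈ Icc 0 T,
      ∫⁻ x, ENNReal.ofReal (FluidPDE.frobeniusNormSq (fderiv ℝ (u t) x)) < ⊤ := fun t ht =>
    lt_of_le_of_lt (hfrob_le t ht) (ENNReal.mul_lt_top (by norm_num) ENNReal.coe_lt_top)
  have hDu_lt : ∀ t ∈ Icc 0 T, ∫⁻ x, ‖fderiv ℝ (u t) x‖ₑ ^ 2 < ⊤ := fun t ht =>
    lintegral_enorm_sq_fderiv_lt_top (hfrob_lt t ht)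
  have hDW_le : ∀ t ∈ Icc 0 T, ∫⁻ x, ‖fderiv ℝ (W t) x‖ₑ ^ 2 ≤ C₂ := fun t ht => by
    calc ∫⁻ x, ‖fderiv ℝ (W t) x‖ₑ ^ 2 = ∫⁻ x, ‖iteratedFDeriv ℝ 1 (W t) x‖ₑ ^ 2 :=
          lintegral_congr fun x => by
            rw [← ofReal_norm, ← norm_iteratedFDeriv_one, ofReal_norm]
      _ ≤ C₂ := hC₂ t ht
  -- integrability of the slices of `|∇u|²` and the identity `ofReal (G t) = ∫⁻ ofReal |∇u|²`
  have ifrob : ∀ t ∈ Icc 0 T, Integrable (fun x => FluidPDE.frobeniusNormSq (fderiv ℝ (u t) x)) volume :=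
    fun t ht => integrable_of_continuous_of_nonneg
      (FluidPDE.continuous_frobeniusNormSq_fderiv (hsol.contDiff_velocity ht) (by simp))
      (fun x => FluidPDE.frobeniusNormSq_nonneg _) (hfrob_lt t ht)
  have hGeq : ∀ t ∈ Icc 0 T, ENNReal.ofReal (G t) =
      ∫⁻ x, ENNReal.ofReal (FluidPDE.frobeniusNormSq (fderiv ℝ (u t) x)) := fun t ht =>
    ofReal_integral_eq_lintegral_ofReal (ifrob t ht)
      (Eventually.of_forall fun x => FluidPDE.frobeniusNormSq_nonneg _)
  have hG0 : ∀ t, 0 ≤ G t := fun t => integral_nonneg fun x => FluidPDE.frobeniusNormSq_nonneg _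
  -- pointwise bound `|g| ≤ (3/2)(‖Du‖² + ‖DW‖²)` and integrability of `g` on `(0, T) × ℝ³`
  have hgle : ∀ t x, ‖g t x‖ ≤ (3 / 2) * (‖fderiv ℝ (u t) x‖ ^ 2 + ‖fderiv ℝ (W t) x‖ ^ 2) := by
    intro t x
    have h1 : ∀ i, ‖⟪fderiv ℝ (u t) x (e i), fderiv ℝ (W t) x (e i)⟫‖ ≤
        ‖fderiv ℝ (u t) x‖ * ‖fderiv ℝ (W t) x‖ := fun i =>
      (norm_inner_le_norm (𝕜 := ℝ) _ _).trans (mul_le_mul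
        (by simpa [he] using (fderiv ℝ (u t) x).le_opNorm (e i))
        (by simpa [he] using (fderiv ℝ (W t) x).le_opNorm (e i)) (norm_nonneg _) (norm_nonneg _))
    calc ‖g t x‖ ≤ ∑ i, ‖⟪fderiv ℝ (u t) x (e i), fderiv ℝ (W t) x (e i)⟫‖ := norm_sum_le _ _
      _ ≤ ∑ _i : Fin 3, ‖fderiv ℝ (u t) x‖ * ‖fderiv ℝ (W t) x‖ := Finset.sum_le_sum fun i _ => h1 i
      _ = 3 * (‖fderiv ℝ (u t) x‖ * ‖fderiv ℝ (W t) x‖) := by simp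
      _ ≤ (3 / 2) * (‖fderiv ℝ (u t) x‖ ^ 2 + ‖fderiv ℝ (W t) x‖ ^ 2) := by
          nlinarith [sq_nonneg (‖fderiv ℝ (u t) x‖ - ‖fderiv ℝ (W t) x‖)]
  have hg_lint : ∀ t ∈ Icc 0 T, ∫⁻ x, ‖g t x‖ₑ ≤ (3 / 2 : ℝ≥0∞) * (3 * C₁ + C₂) := by
    intro t ht
    have h32 : (3 / 2 : ℝ≥0∞) = ENNReal.ofReal (3 / 2) := by
      rw [ENNReal.ofReal_div_of_pos (by norm_num), ENNReal.ofReal_ofNat, ENNReal.ofReal_ofNat]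
    have hpt : ∀ x, ‖g t x‖ₑ ≤ (3 / 2 : ℝ≥0∞) * (‖fderiv ℝ (u t) x‖ₑ ^ 2 + ‖fderiv ℝ (W t) x‖ₑ ^ 2) := by
      intro x
      have hR : (3 / 2 : ℝ≥0∞) * (‖fderiv ℝ (u t) x‖ₑ ^ 2 + ‖fderiv ℝ (W t) x‖ₑ ^ 2) =
          ENNReal.ofReal ((3 / 2) * (‖fderiv ℝ (u t) x‖ ^ 2 + ‖fderiv ℝ (W t) x‖ ^ 2)) := by
        rw [ENNReal.ofReal_mul (by norm_num), ENNReal.ofReal_add (sq_nonneg _) (sq_nonneg _),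
          ENNReal.ofReal_pow (norm_nonneg _), ENNReal.ofReal_pow (norm_nonneg _), ofReal_norm,
          ofReal_norm, h32]
      rw [hR, ← ofReal_norm]
      exact ENNReal.ofReal_le_ofReal (hgle t x)
    calc ∫⁻ x, ‖g t x‖ₑ ≤ ∫⁻ x, (3 / 2 : ℝ≥0∞) * (‖fderiv ℝ (u t) x‖ₑ ^ 2 + ‖fderiv ℝ (W t) x‖ₑ ^ 2) :=
          lintegral_mono hpt
      _ = (3 / 2 : ℝ≥0∞) * ((∫⁻ x, ‖fderiv ℝ (u t) x‖ₑ ^ 2) + ∫⁻ x, ‖fderiv ℝ (W t) x‖ₑ ^ 2) := by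
          rw [lintegral_const_mul' _ _ (ENNReal.div_ne_top (by simp) (by simp)), lintegral_add_left']
          exact ((hsol.contDiff_velocity ht).continuous_fderiv (by simp)).aemeasurable.enorm.pow_const _
      _ ≤ (3 / 2 : ℝ≥0∞) * (3 * C₁ + C₂) := by
          gcongr
          · calc ∫⁻ x, ‖fderiv ℝ (u t) x‖ₑ ^ 2
                ≤ ∫⁻ x, ENNReal.ofReal (FluidPDE.frobeniusNormSq (fderiv ℝ (u t) x)) :=
                  lintegral_mono fun _ => enorm_sq_fderiv_le_ofReal_frobeniusNormSq _
              _ ≤ 3 * C₁ := hfrob_le t ht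
          · exact hDW_le t ht
  have h32ne : (3 / 2 : ℝ≥0∞) ≠ ⊤ := ENNReal.div_ne_top (by simp) (by simp)
  have hKfin : (3 / 2 : ℝ≥0∞) * (3 * C₁ + C₂) ≠ ⊤ :=
    ENNReal.mul_ne_top h32ne
      (ENNReal.add_ne_top.2 ⟨ENNReal.mul_ne_top (by norm_num) ENNReal.coe_ne_top, ENNReal.coe_ne_top⟩)
  have hg_int : ∀ b ∈ Ioc 0 T, Integrable (uncurry g)
      (((volume : Measure ℝ).restrict (Ioo 0 b)).prod volume) := by
    intro b hb
    refine FluidPDE.integrable_prod_of_continuousOn_of_lintegral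
      (cg.mono (prod_mono (Icc_subset_Icc le_rfl hb.2) Subset.rfl)) ?_
    calc ∫⁻ t in Ioo 0 b, ∫⁻ x, ‖uncurry g (t, x)‖ₑ
        ≤ ∫⁻ _ in Ioo 0 b, (3 / 2 : ℝ≥0∞) * (3 * C₁ + C₂) :=
          setLIntegral_mono' measurableSet_Ioo fun t ht =>
            hg_lint t ⟨ht.1.le, ht.2.le.trans hb.2⟩
      _ < ⊤ := by
          rw [setLIntegral_const]
          exact ENNReal.mul_lt_top hKfin.lt_top (by simp)
  -- the time derivative of `|∇u(t, x)|²` at interior times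
  have hderiv : ∀ t ∈ Ioo 0 T, ∀ x, HasDerivAt (fun τ => FluidPDE.frobeniusNormSq (fderiv ℝ (u τ) x))
      (2 * g t x) t := fun t ht x =>
    hasDerivAt_frobeniusNormSq (hsol.smooth_velocity.hasDerivAt_fderiv_slice_timeDerivWithin
      isOpen_Ioo Ioo_subset_Icc_self ht x)
  -- FTC in `t` for each `x`, on `[0, b]`
  have hFTC : ∀ b ∈ Ioc 0 T, ∀ x, ∫ t in (0 : ℝ)..b, 2 * g t x =
      FluidPDE.frobeniusNormSq (fderiv ℝ (u b) x) - FluidPDE.frobeniusNormSq (fderiv ℝ (u 0) x) := by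
    intro b hb x
    have hsub : Icc 0 b ⊆ Icc 0 T := Icc_subset_Icc le_rfl hb.2
    have hc : ContinuousOn (fun τ => ((τ, x) : ℝ × EuclideanSpace ℝ (Fin 3))) (Icc 0 b) :=
      (continuous_id.prodMk continuous_const).continuousOn
    have hmaps : MapsTo (fun τ => ((τ, x) : ℝ × EuclideanSpace ℝ (Fin 3))) (Icc 0 b)
        (Icc 0 T ×ˢ univ) := fun τ hτ => mk_mem_prod (hsub hτ) (mem_univ x)
    have hcont : ContinuousOn (fun τ => FluidPDE.frobeniusNormSq (fderiv ℝ (u τ) x)) (Icc 0 b) :=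
      (cfrob.comp hc hmaps).congr fun τ _ => rfl
    have hcg : ContinuousOn (fun τ => g τ x) (Icc 0 b) := (cg.comp hc hmaps).congr fun τ _ => rfl
    have hcont' : ContinuousOn (fun τ => 2 * g τ x) (Icc 0 b) := continuousOn_const.mul hcg
    exact intervalIntegral.integral_eq_sub_of_hasDerivAt_of_le
      (f := fun τ => FluidPDE.frobeniusNormSq (fderiv ℝ (u τ) x)) (f' := fun τ => 2 * g τ x) hb.1.le
      hcont (fun t ht => hderiv t ⟨ht.1, ht.2.trans_le hb.2⟩ x)
      (hcont'.intervalIntegrable_of_Icc hb.1.le)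
  -- Fubini: `G b - G 0 = ∫₀ᵇ ∫ 2 g`
  set φ : ℝ → ℝ := fun t => ∫ x, 2 * g t x with hφ
  have hφ_int : IntegrableOn φ (Ioo 0 T) volume :=
    ((hg_int T ⟨hT, le_rfl⟩).const_mul 2).integral_prod_left
  have hGb : ∀ b ∈ Ioc 0 T, G b = G 0 + ∫ t in (0 : ℝ)..b, φ t := by
    intro b hb
    have hI := (hg_int b hb).const_mul 2
    have hswap := integral_integral_swap (μ := (volume : Measure ℝ).restrict (Ioo 0 b))
      (ν := (volume : Measure (EuclideanSpace ℝ (Fin 3)))) (f := fun t x => 2 * g t x) hI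
    -- `∫ x, ∫ t in 0..b, 2 g = ∫ x, (frob b - frob 0) = G b - G 0`
    have hx : ∫ x, ∫ t in Ioo 0 b, 2 * g t x = G b - G 0 := by
      have : (fun x => ∫ t in Ioo 0 b, 2 * g t x) = fun x =>
          FluidPDE.frobeniusNormSq (fderiv ℝ (u b) x) - FluidPDE.frobeniusNormSq (fderiv ℝ (u 0) x) := by
        funext x
        rw [← hFTC b hb x, intervalIntegral.integral_of_le hb.1.le, integral_Ioc_eq_integral_Ioo]
      rw [this, integral_sub (ifrob b ⟨hb.1.le, hb.2⟩) (ifrob 0 ⟨le_rfl, hT.le⟩)]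
    rw [intervalIntegral.integral_of_le hb.1.le, integral_Ioc_eq_integral_Ioo, hφ]
    simp only
    rw [hswap, hx]
    ring
  -- continuity of `G` on `[0, T]`
  have hGcont : ContinuousOn G (Icc 0 T) := by
    have hprim : ContinuousOn (fun b => ∫ t in (0 : ℝ)..b, φ t) (Icc 0 T) := by
      have h := intervalIntegral.continuousOn_primitive_interval (μ := volume) (f := φ) (a := 0)
        (b := T) (by
          rw [uIcc_of_le hT.le]
          exact (hφ_int.congr_set_ae Ioo_ae_eq_Icc.symm))
      rwa [uIcc_of_le hT.le] at h
    have heq : ∀ b ∈ Icc 0 T, G b = G 0 + ∫ t in (0 : ℝ)..b, φ t := by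
      intro b hb
      rcases eq_or_lt_of_le hb.1 with h | h
      · rw [← h]; simp
      · exact hGb b ⟨h, hb.2⟩
    exact (continuousOn_const.add hprim).congr heq
  -- the differential inequality `φ ≤ (2M²/ν) G` on `(0, s)`
  have hφle : ∀ t ∈ Ioo 0 s, φ t ≤ 2 * M ^ 2 / ν * G t := by
    intro t ht
    have htT : t ∈ Ioo 0 T := ⟨ht.1, ht.2.trans_le hs.2⟩
    have htI : t ∈ Icc 0 T := Ioo_subset_Icc_self htT
    have hts : t ∈ Icc 0 s := ⟨ht.1.le, ht.2.le⟩
    obtain ⟨C₀, hC₀⟩ := hut 0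
    obtain ⟨D₂, hD₂⟩ := hu 2
    obtain ⟨D₃, hD₃⟩ := hu 3
    obtain ⟨P₀, hP₀⟩ := hp 0
    obtain ⟨P₁, hP₁⟩ := hp 1
    have hzero : ∀ {f : EuclideanSpace ℝ (Fin 3) → EuclideanSpace ℝ (Fin 3)} {C : ℝ≥0},
        (∫⁻ x, ‖iteratedFDeriv ℝ 0 f x‖ₑ ^ 2 ≤ C) → ∫⁻ x, ‖f x‖ₑ ^ 2 < ⊤ := by
      intro f C h
      refine lt_of_le_of_lt ((le_of_eq (lintegral_congr fun x => ?_)).trans h) ENNReal.coe_lt_top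
      rw [← ofReal_norm, ← ofReal_norm, norm_iteratedFDeriv_zero]
    have hzero' : ∀ {f : EuclideanSpace ℝ (Fin 3) → ℝ} {C : ℝ≥0},
        (∫⁻ x, ‖iteratedFDeriv ℝ 0 f x‖ₑ ^ 2 ≤ C) → ∫⁻ x, ‖f x‖ₑ ^ 2 < ⊤ := by
      intro f C h
      refine lt_of_le_of_lt ((le_of_eq (lintegral_congr fun x => ?_)).trans h) ENNReal.coe_lt_top
      rw [← ofReal_norm, ← ofReal_norm, norm_iteratedFDeriv_zero]
    have hmom : ∀ x, W t x + FluidPDE.convect (u t) (u t) x = ν • (Δ (u t)) x - gradient (p t) x := by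
      intro x
      have h := hsol.momentum t htI x
      simpa [hW] using h
    have hone : ∫⁻ x, ‖iteratedFDeriv ℝ 1 (u t) x‖ₑ ^ 2 < ⊤ := (hC₁ t htI).trans_lt ENNReal.coe_lt_top
    have hslice := integral_sum_inner_fderiv_le_of_momentum_of_split hν
      ((hsol.contDiff_velocity htI).of_le (by norm_cast))
      ((hWsm.contDiff_slice htI).of_le (by norm_cast))
      ((hsol.contDiff_pressure htI).of_le (by norm_cast)) hmom (hsol.divFree t htI)
      (fun x => hB₀ t htI x) (hbm t hts) (hbM t hts) hδ0 (hsmall t hts) hδ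
      hone ((hD₂ t htI).trans_lt ENNReal.coe_lt_top) ((hD₃ t htI).trans_lt ENNReal.coe_lt_top)
      (hzero (hC₀ t htI)) ((hC₂ t htI).trans_lt ENNReal.coe_lt_top)
      (hzero' (hP₀ t htI)) ((hP₁ t htI).trans_lt ENNReal.coe_lt_top)
    have h2 : φ t = 2 * ∫ x, g t x := by
      rw [hφ]
      exact integral_const_mul _ _
    rw [h2]
    have : 2 * (M ^ 2 / ν * ∫ x, FluidPDE.frobeniusNormSq (fderiv ℝ (u t) x)) =
        2 * M ^ 2 / ν * G t := by
      rw [hG]; ring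
    rw [← this]
    exact mul_le_mul_of_nonneg_left hslice (by norm_num)
  -- Grönwall
  set κ : ℝ := 2 * M ^ 2 / ν with hκ
  have hκpos : 0 < κ := by positivity
  have hφ_ii : ∀ t ∈ Icc 0 s, IntervalIntegrable φ volume 0 t := fun t ht =>
    (intervalIntegrable_iff_integrableOn_Ioo_of_le ht.1).2
      (hφ_int.mono_set (Ioo_subset_Ioo le_rfl (ht.2.trans hs.2)))
  have hG_ii : ∀ t ∈ Icc 0 s, IntervalIntegrable (fun τ => κ * G τ + 0) volume 0 t := fun t ht =>
    ((continuousOn_const.mul (hGcont.mono (Icc_subset_Icc le_rfl (ht.2.trans hs.2)))).add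
      continuousOn_const).intervalIntegrable_of_Icc ht.1
  have hineq : ∀ t ∈ Icc 0 s, (∀ τ ∈ Icc 0 t, G τ ≤ Real.exp (κ * s) * G 0 + 1) →
      G t ≤ G 0 + ∫ τ in (0 : ℝ)..t, (κ * G τ + 0) := by
    intro t ht _
    rcases eq_or_lt_of_le ht.1 with h | h
    · rw [← h]; simp
    rw [hGb t ⟨h, ht.2.trans hs.2⟩]
    gcongr
    refine intervalIntegral.integral_mono_ae_restrict ht.1 (hφ_ii t ht) (hG_ii t ht) ?_
    have hre : (volume : Measure ℝ).restrict (Icc 0 t) = volume.restrict (Ioo 0 t) :=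
      Measure.restrict_congr_set Ioo_ae_eq_Icc.symm
    rw [Filter.EventuallyLE, hre, ae_restrict_iff' measurableSet_Ioo]
    exact Eventually.of_forall fun τ hτ => by
      simpa using hφle τ ⟨hτ.1, hτ.2.trans_le ht.2⟩
  have hgron := bootstrap_gronwall_integral (B := Real.exp (κ * s) * G 0 + 1) hs.1 hκpos
    (hGcont.mono (Icc_subset_Icc le_rfl hs.2)) continuousOn_const (fun _ _ => le_rfl) (hG0 0)
    hineq (by simp)
  have hfinal : G s ≤ Real.exp (κ * s) * G 0 := by
    simpa using hgron s ⟨hs.1.le, le_rfl⟩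
  -- back to lower integrals
  rw [← hGeq s ⟨hs.1.le, hs.2⟩, ← hGeq 0 ⟨le_rfl, hT.le⟩, ← ENNReal.ofReal_mul (Real.exp_nonneg _)]
  refine ENNReal.ofReal_le_ofReal (hfinal.trans_eq ?_)
  rw [hκ]
  ring_nf

end Slab

/-! ### Packaged form: a threshold `δ₀(ν) > 0` -/

section Packaged

/-- A smallness threshold for the `L³` part: there is `δ₀ > 0` (depending on `ν` only) with
`2 (δ₀ K)² ≤ ν²`, `K` the Sobolev constant of `‖w‖_{L⁶(ℝ³)} ≤ K ‖Dw‖_{L²(ℝ³)}`. [folklore] -/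
theorem exists_split_threshold {ν : ℝ} (hν : 0 < ν) :
    ∃ δ₀ : ℝ, 0 < δ₀ ∧ 2 * (δ₀ * (SNormLESNormFDerivOfEqConst (EuclideanSpace ℝ (Fin 3))
        (volume : Measure (EuclideanSpace ℝ (Fin 3))) 2 : ℝ)) ^ 2 ≤ ν ^ 2 := by
  set K : ℝ := (SNormLESNormFDerivOfEqConst (EuclideanSpace ℝ (Fin 3))
    (volume : Measure (EuclideanSpace ℝ (Fin 3))) 2 : ℝ) with hK
  have hK0 : 0 ≤ K := NNReal.coe_nonneg _
  refine ⟨ν / (2 * (K + 1)), by positivity, ?_⟩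
  have h1 : ν / (2 * (K + 1)) * K ≤ ν / 2 := by
    rw [div_mul_eq_mul_div, div_le_div_iff₀ (by positivity) (by positivity)]
    nlinarith
  have h2 : 0 ≤ ν / (2 * (K + 1)) * K := by positivity
  nlinarith

/-- **The enstrophy inequality in von Wahl's class, packaged.** For every `ν > 0` there is
`δ₀ > 0` such that: for every classical solution `(u, p)` of the unforced Navier–Stokes system on
a closed slab `[0, T] × ℝ³` in Tao's class (all `L²` Sobolev norms of `u`, `∂ₜu`, `p` bounded on
`[0, T]`), every `M > 0`, `0 < s ≤ T`, and every measurable `b(t)` with `|b(t)| ≤ M` and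
`‖u(t) - b(t)‖_{L³} ≤ δ₀` for `t ∈ [0, s]`,
`∫ |∇u(s)|² ≤ exp (2M²s/ν) ∫ |∇u(0)|²`
(`lintegral_frobeniusNormSq_fderiv_le_mul_exp_of_split` with `exists_split_threshold`). This is the
a-priori estimate showing that `C([0, T]; L³)` is a regularity class (von Wahl 1985;
Lemarié-Rieusset 2016, Prop. 12.3 and Thm. 11.2): along a solution continuous into `L³` the
splitting holds uniformly on compact time intervals. [cite: LemarieRieusset2016, Prop. 12.3 with Thm. 11.2] -/
theorem enstrophy_le_mul_exp_of_split {ν : ℝ} (hν : 0 < ν) :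
    ∃ δ₀ : ℝ, 0 < δ₀ ∧ ∀ ⦃T : ℝ⦄, 0 < T →
      ∀ ⦃u : ℝ → EuclideanSpace ℝ (Fin 3) → EuclideanSpace ℝ (Fin 3)⦄
        ⦃p : ℝ → EuclideanSpace ℝ (Fin 3) → ℝ⦄,
        FluidPDE.IsClassicalNSSolutionOn (Icc 0 T) ν 0 u p → HasBoundedSobolevNormsOn (Icc 0 T) u →
        HasBoundedSobolevNormsOn (Icc 0 T) (FluidPDE.timeDerivWithin (Icc 0 T) u) →
        (∀ n : ℕ, ∃ C : ℝ≥0, ∀ t ∈ Icc 0 T, ∫⁻ x, ‖iteratedFDeriv ℝ n (p t) x‖ₑ ^ 2 ≤ C) →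
        ∀ ⦃M s : ℝ⦄, 0 < M → s ∈ Ioc 0 T →
          ∀ b : ℝ → EuclideanSpace ℝ (Fin 3) → EuclideanSpace ℝ (Fin 3),
            (∀ t ∈ Icc 0 s, AEStronglyMeasurable (b t) volume) →
            (∀ t ∈ Icc 0 s, ∀ x, ‖b t x‖ ≤ M) →
            (∀ t ∈ Icc 0 s, eLpNorm (fun x => u t x - b t x) 3 volume ≤ ENNReal.ofReal δ₀) →
            ∫⁻ x, ENNReal.ofReal (FluidPDE.frobeniusNormSq (fderiv ℝ (u s) x)) ≤
              ENNReal.ofReal (Real.exp (2 * M ^ 2 * s / ν)) *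
                ∫⁻ x, ENNReal.ofReal (FluidPDE.frobeniusNormSq (fderiv ℝ (u 0) x)) := by
  obtain ⟨δ₀, hδ₀, hδ⟩ := exists_split_threshold hν
  exact ⟨δ₀, hδ₀, fun T hT u p hsol hu hut hp M s hM hs b hbm hbM hsmall =>
    lintegral_frobeniusNormSq_fderiv_le_mul_exp_of_split hν hT hsol hu hut hp hM hs b hbm hbM
      hδ₀.le hsmall hδ⟩

end Packaged

end Literature.Analysis.FluidPDE

end
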